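import Mathlib
import HarnessLib
import Summits.PneNP.PneNP.Theses.AeaCutRectangles
import Summits.PneNP.PneNP.Theorems.AeaCutRectanglesDutyRectangles
import Summits.PneNP.PneNP.Theorems.AeaCutRectanglesDutyTransport
import Summits.PneNP.PneNP.Theorems.AeaCutRectanglesSparseWitnesses
import Summits.PneNP.PneNP.Theorems.AeaCutRectanglesNoSparseSupports
import Summits.PneNP.PneNP.Theorems.AeaCutRectanglesCriticalSupport
import Summits.PneNP.PneNP.Theorems.FoolingMeasure.Negative.FoolingMeasureFalseOfHalfSparseCore

/-!
# Crux `FoolingMeasure` (stmt-PneNP-19727) / kill path `NoFoolingMeasure` (stmt-PneNP-19729) — p4 g15: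
# the HALF-TYPE FLOOR — Bob only ever sees ONE HALF, so few *half*-types of robust 4-critical graphs kill X1

Lens «barrier inversion, typed just outside the class», applied at crux level, KILL side; the NEXT LINE after g14.

WHERE g14 LEFT IT.  g13 typed the whole-graph type floor `RobustTypeBound T` («every bisection-robust 4-edge-critical
edge set over `Fin n` is, up to relabelling, one of `≤ T n` listed ones») and proved `T n ≤ 2^{κn} ⇒ ¬X1`.  g14 killed
that HYPOTHESIS in substance (Toft seams over a rigid base: `N^{(1/22-o(1))N}` pairwise non-isomorphic robust 4-critical
graphs, memo BarrierNotesP4g14 §2–§3) and concluded (§8, §5) that no statement of type-counting shape refutes X1 and that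
its own lens output `RigidCoreLocalization κ δ` (core of `≤ 2^{κN}` types + fringe of `≤ δN` vertices) helps a refuter
only for `δ < ε`.  BOTH VERDICTS ARE TOO PESSIMISTIC, and this file proves why.

THE OBSERVATION.  In the rectangle refutation Bob never needs the whole type of the core `F` — only `F[K]` for ONE cut
`K` of size `⌈n/2⌉`, and the refuter CHOOSES `K` per graph (the union bound over all `2^n` cuts is already paid by the
half-sparse branch).  So the right floor counts HALF-TYPES:

* `RobustHalfTypeBound T` (§1): for every `n` some list `𝓛` of `≤ T n` edge sets has: every bisection-robust 4-edge-
  critical `F` has SOME `⌈n/2⌉`-set `K` with `F[K] = (relabel σ H)[K]`, `H ∈ 𝓛` («some half of `F` is a placed listed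
  half»).  `RobustTypeBound T ⇒ RobustHalfTypeBound T` (`robustHalfTypeBound_of_robustTypeBound`), and the converse is
  wildly false: ALL Toft seams over one base `W` share the half `(W - e₀)[K₀]` — one list entry for `N^{Ω(N)}` types.
* THEOREM `foolingMeasure_false_of_fewRobustHalfTypes`: `RobustHalfTypeBound T → (∀ᶠ n, T n ≤ 2^{κn}) → ¬ FoolingMeasure`
  (kill-path link `noFoolingMeasure_of_fewRobustHalfTypes`; g13's theorem is the corollary `…_of_fewRobustTypes`).
  MECHANISM (`one_le_halfCover_bound`, a finite core valid for every `n ≥ 2` and every measure obeying X1's clause with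
  bound `δ` at the `⌈n/2⌉`-cuts): the g13 mixed cover with the fixed cut `B⋆` replaced by the per-graph cut `K`; the
  dictionary is `{window cuts} × {≤ n/2 edges}  ∪  ⋃_{|K| = ⌈n/2⌉} typeDuties K 𝓛`, of size
  `≤ 2^n·(n/2+1)·C(N₂,n/2) + 2^n·|𝓛|·n^{⌈n/2⌉}`, and `C = κ + 6` beats it.
* CONSEQUENCE 1 (`foolingMeasure_false_of_rigidCoreLocalization`, §5): g14's `RigidCoreLocalization κ δ` implies `¬X1`
  for EVERY `δ < 1/2` (not only `δ < ε`): Bob takes his half inside the complement of the fringe, which has `≥ ⌈n/2⌉`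
  vertices; the fringe then contributes zero bits.  (Restated verbatim from `ToftSeam.lean` §5, which is not importable.)
* CONSEQUENCE 2 (`false_of_commonHalves`, §6): FIXED-BASE FAMILIES ARE DEAD AS X1 SUPPORTS.  For every `n ≥ 1`, `κ`, and
  every probability measure whose support graphs are relabellings `relabel τ G` of graphs `G` whose inside at one fixed
  `⌈n/2⌉`-set `K₀` ranges over `≤ 2^{κn}` edge sets, X1's clause with `C = κ + 6` fails at some `⌈n/2⌉`-cut — whatever
  the mixture over `G` and `τ`, no criticality or rigidity needed.  Every (multi-)seam design over one base (g14 §2, §8: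
  base `W` on `≥ 21N/22 ≥ ⌈N/2⌉` vertices, entropy carried by the rim attachments) is such a family with ONE inside
  (`K₀ ⊆ V(W)`), so it dies at `C = 6` with no rigidity computation at all (g14's step (2) «SAT-decide rigidity of the
  W₂₀ arcs» is unnecessary).
* CONSEQUENCE 3 (contrapositive, `foolingMeasure_imp_manyRobustHalfTypes`): the construct side's burden is ENTROPY IN
  EVERY HALF: X1 ⇒ for every `κ`, for infinitely many `n`, every list of `≤ 2^{κn}` edge sets misses, for some bisection-
  robust 4-critical `F`, EVERY `⌈n/2⌉`-half of `F` (no hitting set of size `2^{κn}` for the family of half-type sets).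
* §7, independent and cheap (the typed «R9, Bob side» of ARC-SANDWICH-r2s1g13): RIGID HALVES ARE AFFORDABLE.  If Bob's
  half `G[B]` is rigid on `B` (uniquely 3-colourable as a labelled partition, `RigidInside`), `G` lies in the ONE duty
  rectangle `dutyRect B (samePartition B c₀)ᶜ`; dictionary `≤ 2^n·3^n`, so for every `n ≥ 1` and `C ≥ 3` no measure all
  of whose support graphs have a rigid near-half obeys the clause (`false_of_rigidHalves`; margin `n^{n/2}`).  Rigid
  halves of ANY number of types and flexible halves of FEW types are thus both affordable; what X1 needs is halves that
  are simultaneously FLEXIBLE and TYPE-RICH at every bisection of every support core (memo BarrierNotesP4g15 §4).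

§0 restates g12/g13 vocabulary VERBATIM (`Col3`, `RectClause`, `foolingMeasure_schedule`, `BisectionRobustCritical`,
`RobustTypeBound`, the type duties `typeBob`/`typeDuties` and their count, the threshold arithmetic) because crux workfiles
are not importable on the farm (`TypeFloor.lean` is «unbuilt»); the new content is §1–§2 and §5–§7.

HONEST FRAMING.  Elementary counting over the tree's duty-rectangle engine; conditional refutations of X1 / conditional
proofs of the kill-path item modulo OPEN finite-graph-theory statements (few half-types / rigid-core localization), and
unconditional kills of two further SPECIES of candidate measures (fixed-base families; rigid-half supports).  FRONTIER
material for a rung of Fagin's complement ladder (NON-3-COL vs monadic-style cut rectangles).  Nothing here bears on P vs NP.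
-/

set_option linter.dupNamespace false
set_option autoImplicit false

namespace Summit.PneNP.PneNP.Cruxes.FoolingMeasure.P4g15

open Finset
open Summit.PneNP.PneNP.Theorems.AeaCutRectanglesDutyRectangles
open Summit.PneNP.PneNP.Theorems.AeaCutRectanglesDutyTransport
open Summit.PneNP.PneNP.Theorems.AeaCutRectanglesSparseWitnesses
open Summit.PneNP.PneNP.Theorems.AeaCutRectanglesNoSparseSupports
open Summit.PneNP.PneNP.Theorems.AeaCutRectanglesCriticalSupport
open Summit.PneNP.PneNP.Theorems.FoolingMeasure.Negative

/-! ### §0  Vocabulary restated verbatim from g12/g13 (`ImpliedAtomCore.lean`, `TypeFloor.lean` — not importable) -/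

/-- 3-colourability of the graph of an edge set over `Fin n`. -/
abbrev Col3 {n : ℕ} (G : Finset (Sym2 (Fin n))) : Prop :=
  (SimpleGraph.fromEdgeSet (G : Set (Sym2 (Fin n)))).Colorable 3

/-- X1's rectangle clause at the cut `B` with bound `δ` (the three hypotheses of the crux verbatim). -/
def RectClause {V : Type*} [Fintype V] [DecidableEq V] (μ : Finset (Sym2 V) → ℝ) (B : Finset V) (δ : ℝ) :
    Prop :=
  ∀ 𝓐 𝓑 : Finset (Finset (Sym2 V)),
    (∀ α ∈ 𝓐, ∀ e ∈ α, ¬ e.IsDiag ∧ ∃ v ∈ e, v ∉ B) →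
    (∀ β ∈ 𝓑, ∀ e ∈ β, ¬ e.IsDiag ∧ ∀ v ∈ e, v ∈ B) →
    (∀ α ∈ 𝓐, ∀ β ∈ 𝓑,
      ¬ (SimpleGraph.fromEdgeSet ((α ∪ β : Finset (Sym2 V)) : Set (Sym2 V))).Colorable 3) →
    ∑ q ∈ 𝓐 ×ˢ 𝓑, μ (q.1 ∪ q.2) ≤ δ

/-- From X1: for every `C` and `N` some `n ≥ N`, `n ≥ 2`, carries a measure satisfying the clause with bound
`2^{-(n/2)·log₂ n - C·n}` at every cut of size `⌈n/2⌉` (those cuts lie in X1's window once `ε·n ≥ 1`).  [g12] -/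
theorem foolingMeasure_schedule (hX1 : Summit.PneNP.PneNP.Theses.AeaCutRectangles.FoolingMeasure) (C N : ℕ) :
    ∃ n, N ≤ n ∧ 2 ≤ n ∧ ∃ μ : Finset (Sym2 (Fin n)) → ℝ, (∀ S, 0 ≤ μ S) ∧ (∑ S, μ S = 1) ∧
      (∀ S, μ S ≠ 0 → (∀ e ∈ S, ¬ e.IsDiag) ∧ ¬ Col3 S) ∧
      ∀ B : Finset (Fin n), n ≤ 2 * B.card → 2 * B.card ≤ n + 1 →
        RectClause μ B ((2 : ℝ) ^ (-((n : ℝ) / 2 * Real.logb 2 n) - ((C : ℕ) : ℝ) * n)) := by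
  obtain ⟨ε, hε0, -, hC⟩ := hX1
  obtain ⟨N₀, hN₀⟩ := exists_nat_gt (1 / ε)
  obtain ⟨n, hnN, μ, hμ, hsum, hs, hX⟩ := Filter.frequently_atTop.1 (hC C) (N₀ + N + 2)
  have hnε : (1 : ℝ) ≤ ε * n := by
    have hNn : (N₀ : ℝ) ≤ n := by exact_mod_cast (show N₀ ≤ n by omega)
    have h := mul_le_mul_of_nonneg_left hNn hε0.le
    have h' : 1 < ε * N₀ := by
      rw [div_lt_iff₀ hε0] at hN₀
      linarith
    linarith
  refine ⟨n, by omega, by omega, μ, hμ, hsum, hs, fun B h1 h2 => ?_⟩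
  have h1' : (n : ℝ) ≤ 2 * (B.card : ℝ) := by exact_mod_cast h1
  have h2' : 2 * (B.card : ℝ) ≤ n + 1 := by exact_mod_cast h2
  exact hX B (by nlinarith) (by nlinarith)

/-- A BISECTION-ROBUST 4-edge-critical edge set over `Fin n` [g13]: edge-critical, and every vertex set of size `≥ n/2`
spans MORE than `n/2` of its edges. -/
def BisectionRobustCritical {n : ℕ} (F : Finset (Sym2 (Fin n))) : Prop :=
  IsEdgeCritical F ∧ ∀ S : Finset (Fin n), n ≤ 2 * S.card → n < 2 * (bobSide S F).card

/-- ROBUST TYPE BOUND `T` [g13]: for every `n` a list of at most `T n` edge sets over `Fin n` contains every bisection-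
robust 4-edge-critical edge set up to relabelling.  (Refuted in substance for `T n = 2^{O(n)}` by g14's Toft seams.) -/
def RobustTypeBound (T : ℕ → ℕ) : Prop :=
  ∀ n : ℕ, ∃ 𝓣 : Finset (Finset (Sym2 (Fin n))), 𝓣.card ≤ T n ∧
    ∀ F : Finset (Sym2 (Fin n)), BisectionRobustCritical F →
      ∃ H ∈ 𝓣, ∃ σ : Equiv.Perm (Fin n), F = relabel σ H

section TypeDuties

variable {n : ℕ}

/-- Extension of a map `B → Fin n` to `Fin n` (identity off `B`). [g13] -/
def ext (B : Finset (Fin n)) (φ : B → Fin n) : Fin n → Fin n :=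
  fun v => if h : v ∈ B then φ ⟨v, h⟩ else v

theorem ext_apply_mem (B : Finset (Fin n)) (φ : B → Fin n) {v : Fin n} (hv : v ∈ B) :
    ext B φ v = φ ⟨v, hv⟩ := by
  simp [ext, hv]

/-- The TYPE DUTY datum [g13]: the pairs inside `B` whose pull-back under (the extension of) `φ` is an edge of `H`. -/
def typeBob (B : Finset (Fin n)) (H : Finset (Sym2 (Fin n))) (φ : B → Fin n) : Finset (Sym2 (Fin n)) :=
  univ.filter fun e => (∀ v ∈ e, v ∈ B) ∧ Sym2.map (ext B φ) e ∈ H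

/-- Bob's side of a relabelled graph depends only on the restriction of `σ⁻¹` to `B`. [g13] -/
theorem bobSide_relabel_eq_typeBob (B : Finset (Fin n)) (H : Finset (Sym2 (Fin n))) (σ : Equiv.Perm (Fin n)) :
    bobSide B (relabel σ H) = typeBob B H (fun x => σ.symm x.1) := by
  ext e
  rw [mem_bobSide, typeBob, mem_filter]
  constructor
  · rintro ⟨he, hin⟩
    refine ⟨mem_univ _, hin, ?_⟩
    obtain ⟨e', he', rfl⟩ := mem_relabel.1 he
    have hmap : Sym2.map (ext B fun x => σ.symm x.1) (Sym2.map σ e') = e' := by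
      rw [Sym2.map_map]
      calc Sym2.map ((ext B fun x => σ.symm x.1) ∘ σ) e' = Sym2.map (fun x => x) e' := by
            apply Sym2.map_congr
            intro x hx
            have hσx : σ x ∈ B := hin (σ x) (Sym2.mem_map.2 ⟨x, hx, rfl⟩)
            simp [Function.comp, ext_apply_mem B _ hσx]
        _ = e' := congrFun Sym2.map_id' e'
    rw [hmap]
    exact he'
  · rintro ⟨-, hin, hH⟩
    refine ⟨mem_relabel.2 ⟨Sym2.map (ext B fun x => σ.symm x.1) e, hH, ?_⟩, hin⟩
    rw [Sym2.map_map]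
    calc Sym2.map (σ ∘ ext B fun x => σ.symm x.1) e = Sym2.map (fun x => x) e := by
          apply Sym2.map_congr
          intro x hx
          simp [Function.comp, ext_apply_mem B _ (hin x hx)]
      _ = e := congrFun Sym2.map_id' e

/-- The type duties of a list `𝓣` at the cut `B` [g13]: the pairs `(B, typeBob B H φ)`, `H ∈ 𝓣`, `φ : B → Fin n`. -/
noncomputable def typeDuties (B : Finset (Fin n)) (𝓣 : Finset (Finset (Sym2 (Fin n)))) :
    Finset (Finset (Fin n) × Finset (Sym2 (Fin n))) :=
  (𝓣 ×ˢ (univ : Finset (B → Fin n))).image fun p => (B, typeBob B p.1 p.2)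

/-- Count [g13]: `#typeDuties B 𝓣 ≤ |𝓣| · n^{|B|}`. -/
theorem card_typeDuties_le (B : Finset (Fin n)) (𝓣 : Finset (Finset (Sym2 (Fin n)))) :
    (typeDuties B 𝓣).card ≤ 𝓣.card * n ^ B.card := by
  classical
  calc (typeDuties B 𝓣).card ≤ (𝓣 ×ˢ (univ : Finset (B → Fin n))).card := card_image_le
    _ = 𝓣.card * n ^ B.card := by
        rw [card_product, card_univ, Fintype.card_fun, Fintype.card_coe, Fintype.card_fin]

/-- Membership [g13]: the duty `(B, (relabel σ H)[B])`, `H ∈ 𝓣`, is a type duty. -/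
theorem mem_typeDuties {B : Finset (Fin n)} {𝓣 : Finset (Finset (Sym2 (Fin n)))} {H : Finset (Sym2 (Fin n))}
    (hH : H ∈ 𝓣) (σ : Equiv.Perm (Fin n)) :
    (B, bobSide B (relabel σ H)) ∈ typeDuties B 𝓣 := by
  classical
  rw [typeDuties, mem_image]
  exact ⟨(H, fun x => σ.symm x.1), mem_product.2 ⟨hH, mem_univ _⟩,
    by rw [bobSide_relabel_eq_typeBob]⟩

end TypeDuties

/-! ### §1  Halves under relabelling; the HALF-TYPE bound -/

section Halves

variable {n : ℕ}

/-- Bob's side is idempotent. -/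
theorem bobSide_bobSide (K : Finset (Fin n)) (F : Finset (Sym2 (Fin n))) :
    bobSide K (bobSide K F) = bobSide K F := by
  ext e
  simp only [mem_bobSide]
  tauto

/-- Transport of Bob's side: the inside of `relabel τ G` at `τ(K₀)` is the relabelled inside of `G` at `K₀`. -/
theorem bobSide_image_relabel (τ : Equiv.Perm (Fin n)) (K₀ : Finset (Fin n)) (G : Finset (Sym2 (Fin n))) :
    bobSide (K₀.image τ) (relabel τ G) = relabel τ (bobSide K₀ G) := by
  ext e
  rw [mem_bobSide, mem_relabel, mem_relabel]
  constructor
  · rintro ⟨⟨e', he', rfl⟩, hin⟩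
    refine ⟨e', mem_bobSide.2 ⟨he', fun v hv => ?_⟩, rfl⟩
    have hv' : τ v ∈ K₀.image τ := hin (τ v) (Sym2.mem_map.2 ⟨v, hv, rfl⟩)
    obtain ⟨k, hk, hkv⟩ := mem_image.1 hv'
    rw [← τ.injective hkv]
    exact hk
  · rintro ⟨e', he', rfl⟩
    obtain ⟨he'G, hin⟩ := mem_bobSide.1 he'
    refine ⟨⟨e', he'G, rfl⟩, fun v hv => ?_⟩
    obtain ⟨w, hw, rfl⟩ := Sym2.mem_map.1 hv
    exact mem_image.2 ⟨w, hin w hw, rfl⟩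

/-- Relabelling by the identity. -/
theorem relabel_refl (F : Finset (Sym2 (Fin n))) : relabel (Equiv.refl (Fin n)) F = F := by
  ext e
  simp [relabel]

/-- A FRINGE-AVOIDING HALF: if `F` and `F'` agree on the edges avoiding `R` and `2|R| < n`, some `⌈n/2⌉`-set `K`
(inside `Rᶜ`) has `F[K] = F'[K]`. -/
theorem exists_half_avoiding {F F' : Finset (Sym2 (Fin n))} {R : Finset (Fin n)} (hR : 2 * R.card < n)
    (hagree : ∀ e, e ∈ F ∧ (∀ x ∈ e, x ∉ R) ↔ e ∈ F' ∧ (∀ x ∈ e, x ∉ R)) :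
    ∃ K : Finset (Fin n), K.card = (n + 1) / 2 ∧ bobSide K F = bobSide K F' := by
  obtain ⟨K, hKsub, hKc⟩ := exists_subset_card_eq (s := Rᶜ)
    (show (n + 1) / 2 ≤ Rᶜ.card by rw [card_compl, Fintype.card_fin]; omega)
  refine ⟨K, hKc, ?_⟩
  have hKR : ∀ v ∈ K, v ∉ R := fun v hv => mem_compl.1 (hKsub hv)
  ext e
  simp only [mem_bobSide]
  constructor
  · rintro ⟨he, hin⟩
    exact ⟨((hagree e).1 ⟨he, fun x hx => hKR x (hin x hx)⟩).1, hin⟩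
  · rintro ⟨he, hin⟩
    exact ⟨((hagree e).2 ⟨he, fun x hx => hKR x (hin x hx)⟩).1, hin⟩

end Halves

/-- **ROBUST HALF-TYPE BOUND** `T`: for every `n` a list `𝓛` of at most `T n` edge sets over `Fin n` such that every
bisection-robust 4-edge-critical edge set `F` has SOME vertex set `K` of size `⌈n/2⌉` whose inside `F[K]` is the
inside of a placed listed graph: `F[K] = (relabel σ H)[K]`, `H ∈ 𝓛`.  (`T n` bounds a HITTING SET for the half-types
of robust 4-critical graphs, not the number of their isomorphism types.)  OPEN for `T n = 2^{O(n)}`; all Toft-seam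
families over one base have a one-element hitting set.  WHY IT MIGHT FAIL: a family of robust 4-critical graphs with
`ω(n)` bits of induced-subgraph entropy in EVERY half (random-lift-like designs) — none is known that also passes the
squeeze «every `≥ n/2` vertices span `> n/2` edges, every single-edge deletion 3-colourable». -/
def RobustHalfTypeBound (T : ℕ → ℕ) : Prop :=
  ∀ n : ℕ, ∃ 𝓛 : Finset (Finset (Sym2 (Fin n))), 𝓛.card ≤ T n ∧
    ∀ F : Finset (Sym2 (Fin n)), BisectionRobustCritical F →
      ∃ K : Finset (Fin n), K.card = (n + 1) / 2 ∧ ∃ H ∈ 𝓛, ∃ σ : Equiv.Perm (Fin n),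
        bobSide K F = bobSide K (relabel σ H)

/-- `RobustHalfTypeBound` is monotone in the bound. -/
theorem RobustHalfTypeBound.mono {T T' : ℕ → ℕ} (h : ∀ n, T n ≤ T' n) (hT : RobustHalfTypeBound T) :
    RobustHalfTypeBound T' := by
  intro n
  obtain ⟨𝓛, hc, hcov⟩ := hT n
  exact ⟨𝓛, hc.trans (h n), hcov⟩

/-- **Whole types bound half types**: `RobustTypeBound T → RobustHalfTypeBound T` (same list, any fixed half). -/
theorem robustHalfTypeBound_of_robustTypeBound {T : ℕ → ℕ} (hT : RobustTypeBound T) :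
    RobustHalfTypeBound T := by
  intro n
  obtain ⟨𝓣, hc, hcov⟩ := hT n
  obtain ⟨K, -, hK⟩ := exists_subset_card_eq (s := (univ : Finset (Fin n)))
    (show (n + 1) / 2 ≤ (univ : Finset (Fin n)).card by rw [card_univ, Fintype.card_fin]; omega)
  refine ⟨𝓣, hc, fun F hF => ⟨K, hK, ?_⟩⟩
  obtain ⟨H, hH, σ, rfl⟩ := hcov F hF
  exact ⟨H, hH, σ, rfl⟩

/-! ### §2  The dictionary engine and the mixed half-type cover -/

/-- **ENGINE** (Bob-superset dictionaries).  If every support graph `S` of `μ` admits a duty `q = (B, β)` of the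
dictionary `I` with `β ⊆ S[B]` and `aliceSide B S ∪ β` not 3-colourable, and X1's clause holds with bound `δ` at every
cut of the dictionary, then the total mass is at most `|I| · δ`. -/
theorem sum_le_card_mul_of_cover {n : ℕ} (μ : Finset (Sym2 (Fin n)) → ℝ) (hμ : ∀ S, 0 ≤ μ S)
    (hs : ∀ S, μ S ≠ 0 → (∀ e ∈ S, ¬ e.IsDiag) ∧ ¬ Col3 S) {δ : ℝ}
    (I : Finset (Finset (Fin n) × Finset (Sym2 (Fin n)))) (hI : ∀ q ∈ I, RectClause μ q.1 δ)
    (hcov : ∀ S, μ S ≠ 0 → ∃ q ∈ I, q.2 ⊆ bobSide q.1 S ∧ ¬ Col3 (aliceSide q.1 S ∪ q.2)) :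
    ∑ S, μ S ≤ (I.card : ℝ) * δ := by
  classical
  let p : Finset (Fin n) × Finset (Sym2 (Fin n)) → Finset (Sym2 (Fin n)) → Prop := fun q S =>
    q.2 ⊆ bobSide q.1 S ∧ ¬ Col3 (aliceSide q.1 S ∪ q.2)
  calc ∑ S, μ S ≤ ∑ q ∈ I, ∑ S ∈ univ.filter (p q), μ S := sum_le_sum_cover I p μ hμ hcov
    _ ≤ ∑ _q ∈ I, δ := by
        refine sum_le_sum fun q hq => ?_
        exact bobSupset_le_of_rectClause μ hμ hs (hI q hq) q.2 _ (fun G hG _ => (mem_filter.1 hG).2)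
    _ = (I.card : ℝ) * δ := by rw [sum_const, nsmul_eq_mul]

/-- **MIXED HALF-TYPE COVER BOUND.**  `n ≥ 2`; `μ` a probability measure on loopless non-3-colourable edge sets over
`Fin n` obeying X1's clause with bound `δ` at every cut of size `⌈n/2⌉`; `𝓛` a list such that every bisection-robust
4-edge-critical subgraph `F` of a support graph has a `⌈n/2⌉`-half equal to a placed listed half.  Then
`1 ≤ (2^n·(n/2+1)·C(|Sym2 (Fin n)|, n/2) + 2^n·|𝓛|·n^{⌈n/2⌉}) · δ`. -/
theorem one_le_halfCover_bound {n : ℕ} (hn : 2 ≤ n) (μ : Finset (Sym2 (Fin n)) → ℝ)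
    (hμ : ∀ S, 0 ≤ μ S) (hsum : ∑ S, μ S = 1)
    (hs : ∀ S, μ S ≠ 0 → (∀ e ∈ S, ¬ e.IsDiag) ∧ ¬ Col3 S)
    {δ : ℝ} (hδ : 0 ≤ δ)
    (hX : ∀ B : Finset (Fin n), n ≤ 2 * B.card → 2 * B.card ≤ n + 1 → RectClause μ B δ)
    (𝓛 : Finset (Finset (Sym2 (Fin n))))
    (h𝓛 : ∀ S, μ S ≠ 0 → ∀ F, F ⊆ S → BisectionRobustCritical F →
      ∃ K : Finset (Fin n), K.card = (n + 1) / 2 ∧ ∃ H ∈ 𝓛, ∃ σ : Equiv.Perm (Fin n),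
        bobSide K F = bobSide K (relabel σ H)) :
    (1 : ℝ) ≤ ((((2 ^ n * ((n / 2 + 1) * (Fintype.card (Sym2 (Fin n))).choose (n / 2))) : ℕ) : ℝ) +
      ((2 ^ n * 𝓛.card * n ^ ((n + 1) / 2) : ℕ) : ℝ)) * δ := by
  classical
  set m : ℕ := n / 2 with hm
  set h : ℕ := (n + 1) / 2 with hh
  -- the dictionary
  set P : Finset (Finset (Sym2 (Fin n))) := univ.filter (fun K => K.card ≤ m) with hP
  set Wset : Finset (Finset (Fin n)) := univ.filter (fun B => n ≤ 2 * B.card ∧ 2 * B.card ≤ n + 1) with hW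
  set Hset : Finset (Finset (Fin n)) := univ.filter (fun K => K.card = h) with hHset
  set I : Finset (Finset (Fin n) × Finset (Sym2 (Fin n))) :=
    Wset ×ˢ P ∪ Hset.biUnion (fun K => typeDuties K 𝓛) with hI
  -- every support graph is covered
  have hcov : ∀ S, μ S ≠ 0 → ∃ q ∈ I, q.2 ⊆ bobSide q.1 S ∧ ¬ Col3 (aliceSide q.1 S ∪ q.2) := by
    intro S hS
    obtain ⟨hl, hc⟩ := hs S hS
    have hF := core_critical S hl hc
    have hFS := core_subset S
    set F := core S with hFdef
    by_cases hrob : ∀ S' : Finset (Fin n), n ≤ 2 * S'.card → n < 2 * (bobSide S' F).card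
    · -- robust core: a type duty at the per-graph cut K
      obtain ⟨K, hKc, H, hH, σ, hEq⟩ := h𝓛 S hS F hFS ⟨hF, hrob⟩
      refine ⟨(K, bobSide K F), ?_, ?_, ?_⟩
      · rw [hI, mem_union]
        right
        rw [mem_biUnion]
        refine ⟨K, mem_filter.2 ⟨mem_univ _, hKc⟩, ?_⟩
        rw [hEq]
        exact mem_typeDuties hH σ
      · exact bobSide_mono K hFS
      · exact not_colorable_of_subset (subset_aliceSide_union_bobSide K hFS) hF.2.1
    · -- a half-sparse near-half: a `HalfSparseCore` duty
      push Not at hrob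
      obtain ⟨S', hS', hcard⟩ := hrob
      obtain ⟨B, hBS', hBc⟩ := exists_subset_card_eq (show h ≤ S'.card by omega)
      have hle : (bobSide B F).card ≤ m := by
        have := card_le_card (bobSide_mono_left hBS' F)
        omega
      refine ⟨(B, bobSide B F), ?_, ?_, ?_⟩
      · rw [hI, mem_union]
        left
        refine mem_product.2 ⟨mem_filter.2 ⟨mem_univ _, ?_, ?_⟩, mem_filter.2 ⟨mem_univ _, hle⟩⟩
        · rw [hBc]; omega
        · rw [hBc]; omega
      · exact bobSide_mono B hFS
      · exact not_colorable_of_subset (subset_aliceSide_union_bobSide B hFS) hF.2.1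
  -- every duty of the dictionary sits at a cut of size ⌈n/2⌉ (or a window cut)
  have hcut : ∀ q ∈ I, n ≤ 2 * q.1.card ∧ 2 * q.1.card ≤ n + 1 := by
    intro q hq
    rw [hI, mem_union] at hq
    rcases hq with hq | hq
    · obtain ⟨hB, -⟩ := mem_product.1 hq
      exact (mem_filter.1 hB).2
    · rw [mem_biUnion] at hq
      obtain ⟨K, hK, hq⟩ := hq
      have hKc := (mem_filter.1 hK).2
      rw [typeDuties, mem_image] at hq
      obtain ⟨p', -, rfl⟩ := hq
      refine ⟨?_, ?_⟩ <;> · dsimp only; omega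
  -- union bound
  have htot : ∑ S, μ S ≤ (I.card : ℝ) * δ :=
    sum_le_card_mul_of_cover μ hμ hs I (fun q hq => hX q.1 (hcut q hq).1 (hcut q hq).2) hcov
  rw [hsum] at htot
  -- count
  have hIcard : I.card ≤ 2 ^ n * ((n / 2 + 1) * (Fintype.card (Sym2 (Fin n))).choose (n / 2)) +
      2 ^ n * 𝓛.card * n ^ ((n + 1) / 2) := by
    have hWc : Wset.card ≤ 2 ^ n := by
      calc Wset.card ≤ (univ : Finset (Finset (Fin n))).card := card_le_card (filter_subset _ _)
        _ = 2 ^ n := by rw [card_univ, Fintype.card_finset, Fintype.card_fin]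
    have hHc : Hset.card ≤ 2 ^ n := by
      calc Hset.card ≤ (univ : Finset (Finset (Fin n))).card := card_le_card (filter_subset _ _)
        _ = 2 ^ n := by rw [card_univ, Fintype.card_finset, Fintype.card_fin]
    have hPc : P.card ≤ (n / 2 + 1) * (Fintype.card (Sym2 (Fin n))).choose (n / 2) :=
      card_filter_card_le_choose (Sym2 (Fin n)) m
        ((show 2 * m ≤ n by omega).trans (le_card_sym2_fin (by omega)))
    have hTc : (Hset.biUnion fun K => typeDuties K 𝓛).card ≤ 2 ^ n * 𝓛.card * n ^ h := by
      calc (Hset.biUnion fun K => typeDuties K 𝓛).card ≤ ∑ K ∈ Hset, (typeDuties K 𝓛).card := card_biUnion_le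
        _ ≤ ∑ K ∈ Hset, 𝓛.card * n ^ h := by
            refine sum_le_sum fun K hK => ?_
            have h1 := card_typeDuties_le K 𝓛
            rw [(mem_filter.1 hK).2] at h1
            exact h1
        _ = Hset.card * (𝓛.card * n ^ h) := by rw [sum_const, smul_eq_mul]
        _ ≤ 2 ^ n * (𝓛.card * n ^ h) := Nat.mul_le_mul_right _ hHc
        _ = 2 ^ n * 𝓛.card * n ^ h := (Nat.mul_assoc _ _ _).symm
    calc I.card ≤ (Wset ×ˢ P).card + (Hset.biUnion fun K => typeDuties K 𝓛).card := card_union_le _ _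
      _ ≤ 2 ^ n * ((n / 2 + 1) * (Fintype.card (Sym2 (Fin n))).choose (n / 2)) +
          2 ^ n * 𝓛.card * n ^ ((n + 1) / 2) := by
          rw [card_product]
          exact Nat.add_le_add (Nat.mul_le_mul hWc hPc) hTc
  have hIcardR : (I.card : ℝ) ≤ ((((2 ^ n * ((n / 2 + 1) * (Fintype.card (Sym2 (Fin n))).choose (n / 2))) :
      ℕ) : ℝ) + ((2 ^ n * 𝓛.card * n ^ ((n + 1) / 2) : ℕ) : ℝ)) := by
    exact_mod_cast hIcard
  have := mul_le_mul_of_nonneg_right hIcardR hδ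
  linarith

/-! ### §3  Threshold arithmetic (g13, restated) -/

/-- The X1 budget at `C` splits off the budget at `4`:  `δ_C = δ_4 · 2^{-(C-4)·n}` for `C ≥ 4`. -/
theorem delta_split {n C : ℕ} (hC : 4 ≤ C) :
    (2 : ℝ) ^ (-((n : ℝ) / 2 * Real.logb 2 n) - ((C : ℕ) : ℝ) * n) =
      (2 : ℝ) ^ (-((n : ℝ) / 2 * Real.logb 2 n) - ((4 : ℕ) : ℝ) * n) * ((2 : ℝ) ^ ((C - 4) * n))⁻¹ := by
  have hC' : ((C : ℕ) : ℝ) = ((4 : ℕ) : ℝ) + ((C - 4 : ℕ) : ℝ) := by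
    rw [← Nat.cast_add]; congr 1; omega
  rw [hC', add_mul, ← sub_sub, Real.rpow_sub (by norm_num) _ (((C - 4 : ℕ) : ℝ) * n)]
  rw [div_eq_mul_inv]
  congr 2
  rw [show ((C - 4 : ℕ) : ℝ) * (n : ℝ) = (((C - 4) * n : ℕ) : ℝ) by push_cast; ring, Real.rpow_natCast]

/-- The X1 budget at `C` as `n^{-n/2} · 2^{-C n}`. -/
theorem delta_eq {n C : ℕ} (hn : 1 ≤ n) :
    (2 : ℝ) ^ (-((n : ℝ) / 2 * Real.logb 2 n) - ((C : ℕ) : ℝ) * n) =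
      ((n : ℝ) ^ ((n : ℝ) / 2))⁻¹ * ((2 : ℝ) ^ (C * n))⁻¹ := by
  rw [Real.rpow_sub (by norm_num), Real.rpow_neg (by norm_num), two_rpow_half_logb hn, div_eq_mul_inv]
  congr 2
  rw [show ((C : ℕ) : ℝ) * (n : ℝ) = ((C * n : ℕ) : ℝ) by push_cast; ring, Real.rpow_natCast]

/-- `n^{⌈n/2⌉} ≤ n · n^{n/2}` (real exponent on the right). -/
theorem pow_ceil_half_le {n : ℕ} (hn : 1 ≤ n) :
    ((n ^ ((n + 1) / 2) : ℕ) : ℝ) ≤ (n : ℝ) * (n : ℝ) ^ ((n : ℝ) / 2) := by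
  have hn1 : (1 : ℝ) ≤ n := by exact_mod_cast hn
  have hn0 : (0 : ℝ) < n := by linarith
  push_cast
  rw [← Real.rpow_natCast]
  calc (n : ℝ) ^ ((((n + 1) / 2 : ℕ)) : ℝ) ≤ (n : ℝ) ^ (1 + (n : ℝ) / 2) := by
        apply Real.rpow_le_rpow_of_exponent_le hn1
        have : (2 * ((n + 1) / 2 : ℕ) : ℝ) ≤ n + 1 := by exact_mod_cast (show 2 * ((n + 1) / 2) ≤ n + 1 by omega)
        linarith
    _ = (n : ℝ) * (n : ℝ) ^ ((n : ℝ) / 2) := by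
        rw [Real.rpow_add hn0, Real.rpow_one]

/-- The type count beats the threshold [g13]: `T ≤ 2^{κ n}` and `C = κ + 5` give `T·n^{⌈n/2⌉}·δ_C ≤ 1/16`. -/
theorem type_term_le {n κ T : ℕ} (hn : 1 ≤ n) (hT : T ≤ 2 ^ (κ * n)) :
    ((T * n ^ ((n + 1) / 2) : ℕ) : ℝ) * (2 : ℝ) ^ (-((n : ℝ) / 2 * Real.logb 2 n) - ((κ + 5 : ℕ) : ℝ) * n)
      ≤ 1 / 16 := by
  have hn1 : (1 : ℝ) ≤ n := by exact_mod_cast hn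
  have hn0 : (0 : ℝ) < n := by linarith
  have hA : (0 : ℝ) < (n : ℝ) ^ ((n : ℝ) / 2) := Real.rpow_pos_of_pos hn0 _
  rw [delta_eq hn]
  have hTR : ((T : ℕ) : ℝ) ≤ (2 : ℝ) ^ (κ * n) := by exact_mod_cast hT
  have hpow := pow_ceil_half_le hn
  have hnum : ((T * n ^ ((n + 1) / 2) : ℕ) : ℝ) ≤ (2 : ℝ) ^ (κ * n) * ((n : ℝ) * (n : ℝ) ^ ((n : ℝ) / 2)) := by
    push_cast
    have h1 : ((T : ℕ) : ℝ) * ((n : ℝ) ^ ((n + 1) / 2)) ≤ (2 : ℝ) ^ (κ * n) * ((n : ℝ) ^ ((n + 1) / 2)) :=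
      mul_le_mul_of_nonneg_right hTR (by positivity)
    have h2 : (2 : ℝ) ^ (κ * n) * ((n : ℝ) ^ ((n + 1) / 2)) ≤
        (2 : ℝ) ^ (κ * n) * ((n : ℝ) * (n : ℝ) ^ ((n : ℝ) / 2)) := by
      apply mul_le_mul_of_nonneg_left _ (by positivity)
      exact_mod_cast hpow
    exact h1.trans h2
  have hn2 : (n : ℝ) ≤ (2 : ℝ) ^ n := by exact_mod_cast Nat.lt_two_pow_self.le
  have h16 : (16 : ℝ) ≤ (16 : ℝ) ^ n := by
    calc (16 : ℝ) = 16 ^ 1 := by norm_num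
      _ ≤ 16 ^ n := pow_le_pow_right₀ (by norm_num) hn
  have hsplit : (2 : ℝ) ^ ((κ + 5) * n) = (2 : ℝ) ^ (κ * n) * (2 : ℝ) ^ n * (16 : ℝ) ^ n := by
    rw [show (κ + 5) * n = κ * n + n + 4 * n by ring, pow_add, pow_add,
      show (2 : ℝ) ^ (4 * n) = 16 ^ n by rw [pow_mul]; norm_num]
  calc ((T * n ^ ((n + 1) / 2) : ℕ) : ℝ) * (((n : ℝ) ^ ((n : ℝ) / 2))⁻¹ * ((2 : ℝ) ^ ((κ + 5) * n))⁻¹)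
      ≤ (2 : ℝ) ^ (κ * n) * ((n : ℝ) * (n : ℝ) ^ ((n : ℝ) / 2)) *
          (((n : ℝ) ^ ((n : ℝ) / 2))⁻¹ * ((2 : ℝ) ^ ((κ + 5) * n))⁻¹) :=
        mul_le_mul_of_nonneg_right hnum (by positivity)
    _ = (n : ℝ) / ((2 : ℝ) ^ n * (16 : ℝ) ^ n) := by
        rw [hsplit]
        have hA' : (n : ℝ) ^ ((n : ℝ) / 2) ≠ 0 := hA.ne'
        field_simp
    _ ≤ (2 : ℝ) ^ n / ((2 : ℝ) ^ n * (16 : ℝ) ^ n) := by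
        gcongr
    _ = 1 / (16 : ℝ) ^ n := by
        field_simp
    _ ≤ 1 / 16 := by
        gcongr

/-- The half-type count beats the threshold: `|𝓛| ≤ 2^{κn}` and `C = κ + 6` give `2^n·|𝓛|·n^{⌈n/2⌉}·δ_C ≤ 1/16`. -/
theorem halfType_term_le {n κ L : ℕ} (hn : 1 ≤ n) (hL : L ≤ 2 ^ (κ * n)) :
    ((2 ^ n * L * n ^ ((n + 1) / 2) : ℕ) : ℝ) *
      (2 : ℝ) ^ (-((n : ℝ) / 2 * Real.logb 2 n) - ((κ + 6 : ℕ) : ℝ) * n) ≤ 1 / 16 := by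
  have h1 : 2 ^ n * L ≤ 2 ^ ((κ + 1) * n) := by
    calc 2 ^ n * L ≤ 2 ^ n * 2 ^ (κ * n) := Nat.mul_le_mul_left _ hL
      _ = 2 ^ ((κ + 1) * n) := by rw [← pow_add]; congr 1; ring
  have h2 := type_term_le (n := n) (κ := κ + 1) (T := 2 ^ n * L) hn h1
  have e6 : κ + 1 + 5 = κ + 6 := rfl
  rw [e6] at h2
  exact h2

/-- The half-sparse term at `C ≥ 5`: `(2^n·(n/2+1)·C(N,n/2))·δ_C ≤ 1/2`. -/
theorem sparse_term_le {n C : ℕ} (hn : 2 ≤ n) (hC : 5 ≤ C) :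
    (((2 ^ n * ((n / 2 + 1) * (Fintype.card (Sym2 (Fin n))).choose (n / 2))) : ℕ) : ℝ) *
      (2 : ℝ) ^ (-((n : ℝ) / 2 * Real.logb 2 n) - ((C : ℕ) : ℝ) * n) ≤ 1 / 2 := by
  have hlt := halfSparse_count_lt_one hn
  have hsplit := @delta_split n C (by omega)
  have hE : (2 : ℝ) ≤ (2 : ℝ) ^ ((C - 4) * n) := by
    have h1 : 1 ≤ (C - 4) * n := by
      calc 1 = 1 * 1 := rfl
        _ ≤ (C - 4) * n := Nat.mul_le_mul (by omega) (by omega)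
    calc (2 : ℝ) = 2 ^ 1 := by norm_num
      _ ≤ 2 ^ ((C - 4) * n) := pow_le_pow_right₀ (by norm_num) h1
  have hEpos : (0 : ℝ) < (2 : ℝ) ^ ((C - 4) * n) := by positivity
  have hcast : (((2 ^ n * ((n / 2 + 1) * (Fintype.card (Sym2 (Fin n))).choose (n / 2))) : ℕ) : ℝ) =
      ((2 ^ n : ℕ) : ℝ) * ((((n / 2 + 1) * (Fintype.card (Sym2 (Fin n))).choose (n / 2)) : ℕ) : ℝ) := by
    push_cast; ring
  have hA4 : (((2 ^ n * ((n / 2 + 1) * (Fintype.card (Sym2 (Fin n))).choose (n / 2))) : ℕ) : ℝ) *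
      (2 : ℝ) ^ (-((n : ℝ) / 2 * Real.logb 2 n) - ((4 : ℕ) : ℝ) * n) < 1 := by
    rw [hcast, mul_assoc]; exact hlt
  calc (((2 ^ n * ((n / 2 + 1) * (Fintype.card (Sym2 (Fin n))).choose (n / 2))) : ℕ) : ℝ) *
        (2 : ℝ) ^ (-((n : ℝ) / 2 * Real.logb 2 n) - ((C : ℕ) : ℝ) * n)
      = ((((2 ^ n * ((n / 2 + 1) * (Fintype.card (Sym2 (Fin n))).choose (n / 2))) : ℕ) : ℝ) *
          (2 : ℝ) ^ (-((n : ℝ) / 2 * Real.logb 2 n) - ((4 : ℕ) : ℝ) * n)) *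
          ((2 : ℝ) ^ ((C - 4) * n))⁻¹ := by rw [hsplit]; ring
    _ ≤ 1 * (2 : ℝ)⁻¹ :=
        mul_le_mul hA4.le (inv_anti₀ (by norm_num) hE) (inv_nonneg.2 hEpos.le) zero_le_one
    _ = 1 / 2 := by norm_num

/-! ### §4  The conditional refutation and its contrapositive -/

/-- **FINITE CORE OF THE HALF-TYPE KILL.**  For every `n ≥ 2` and `κ`: no probability measure on loopless non-3-
colourable edge sets over `Fin n`, all of whose support graphs' bisection-robust critical subgraphs have a `⌈n/2⌉`-half
among the placed halves of `≤ 2^{κn}` listed graphs, obeys X1's clause with `C = κ + 6` at every `⌈n/2⌉`-cut. -/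
theorem false_of_halfCover {n κ : ℕ} (hn : 2 ≤ n) (μ : Finset (Sym2 (Fin n)) → ℝ)
    (hμ : ∀ S, 0 ≤ μ S) (hsum : ∑ S, μ S = 1)
    (hs : ∀ S, μ S ≠ 0 → (∀ e ∈ S, ¬ e.IsDiag) ∧ ¬ Col3 S)
    (𝓛 : Finset (Finset (Sym2 (Fin n)))) (h𝓛card : 𝓛.card ≤ 2 ^ (κ * n))
    (h𝓛 : ∀ S, μ S ≠ 0 → ∀ F, F ⊆ S → BisectionRobustCritical F →
      ∃ K : Finset (Fin n), K.card = (n + 1) / 2 ∧ ∃ H ∈ 𝓛, ∃ σ : Equiv.Perm (Fin n),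
        bobSide K F = bobSide K (relabel σ H))
    (hX : ∀ B : Finset (Fin n), n ≤ 2 * B.card → 2 * B.card ≤ n + 1 →
      RectClause μ B ((2 : ℝ) ^ (-((n : ℝ) / 2 * Real.logb 2 n) - ((κ + 6 : ℕ) : ℝ) * n))) : False := by
  set δ : ℝ := (2 : ℝ) ^ (-((n : ℝ) / 2 * Real.logb 2 n) - ((κ + 6 : ℕ) : ℝ) * n) with hδ
  have hδpos : 0 < δ := Real.rpow_pos_of_pos (by norm_num) _
  have hcore := one_le_halfCover_bound hn μ hμ hsum hs hδpos.le hX 𝓛 h𝓛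
  have hsparse : (((2 ^ n * ((n / 2 + 1) * (Fintype.card (Sym2 (Fin n))).choose (n / 2))) : ℕ) : ℝ) * δ
      ≤ 1 / 2 := sparse_term_le (C := κ + 6) hn (by omega)
  have htype : ((2 ^ n * 𝓛.card * n ^ ((n + 1) / 2) : ℕ) : ℝ) * δ ≤ 1 / 16 :=
    halfType_term_le (by omega) h𝓛card
  have hsum' : ((((2 ^ n * ((n / 2 + 1) * (Fintype.card (Sym2 (Fin n))).choose (n / 2))) : ℕ) : ℝ) +
          ((2 ^ n * 𝓛.card * n ^ ((n + 1) / 2) : ℕ) : ℝ)) * δ =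
        (((2 ^ n * ((n / 2 + 1) * (Fintype.card (Sym2 (Fin n))).choose (n / 2))) : ℕ) : ℝ) * δ +
          ((2 ^ n * 𝓛.card * n ^ ((n + 1) / 2) : ℕ) : ℝ) * δ := by ring
  rw [hsum'] at hcore
  linarith

/-- **X1 IS FALSE IF BISECTION-ROBUST 4-CRITICAL GRAPHS HAVE FEW HALF-TYPES.**  `RobustHalfTypeBound T` with
`T n ≤ 2^{κ n}` for all large `n` refutes `Summit.PneNP.PneNP.Theses.AeaCutRectangles.FoolingMeasure` (at `C = κ + 6`). -/
theorem foolingMeasure_false_of_fewRobustHalfTypes {T : ℕ → ℕ} (hT : RobustHalfTypeBound T) {κ : ℕ}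
    (hκ : ∀ᶠ n in Filter.atTop, T n ≤ 2 ^ (κ * n)) :
    ¬ Summit.PneNP.PneNP.Theses.AeaCutRectangles.FoolingMeasure := by
  intro hX1
  obtain ⟨N, hN⟩ := Filter.eventually_atTop.1 hκ
  obtain ⟨n, hnN, hn2, μ, hμ, hsum, hs, hX⟩ := foolingMeasure_schedule hX1 (κ + 6) N
  obtain ⟨𝓛, h𝓛card, h𝓛⟩ := hT n
  exact false_of_halfCover hn2 μ hμ hsum hs 𝓛 (h𝓛card.trans (hN n hnN)) (fun S _ F _ hF => h𝓛 F hF) hX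

/-- **Kill path (stmt-PneNP-19729) under FEW ROBUST HALF-TYPES.** -/
theorem noFoolingMeasure_of_fewRobustHalfTypes {T : ℕ → ℕ} (hT : RobustHalfTypeBound T) {κ : ℕ}
    (hκ : ∀ᶠ n in Filter.atTop, T n ≤ 2 ^ (κ * n)) :
    Summit.PneNP.PneNP.Theses.AeaCutRectangles.NoFoolingMeasure := by
  unfold Summit.PneNP.PneNP.Theses.AeaCutRectangles.NoFoolingMeasure
  exact foolingMeasure_false_of_fewRobustHalfTypes hT hκ

/-- g13's theorem recovered: few WHOLE types suffice a fortiori. -/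
theorem foolingMeasure_false_of_fewRobustTypes {T : ℕ → ℕ} (hT : RobustTypeBound T) {κ : ℕ}
    (hκ : ∀ᶠ n in Filter.atTop, T n ≤ 2 ^ (κ * n)) :
    ¬ Summit.PneNP.PneNP.Theses.AeaCutRectangles.FoolingMeasure :=
  foolingMeasure_false_of_fewRobustHalfTypes (robustHalfTypeBound_of_robustTypeBound hT) hκ

/-- **The construct side's burden, as a theorem: ENTROPY IN EVERY HALF.**  X1 forces, for every `κ`, infinitely many
`n` such that every list of `≤ 2^{κ n}` edge sets over `Fin n` misses, for some bisection-robust 4-edge-critical `F`,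
EVERY `⌈n/2⌉`-half of `F`: no `F[K]` (`|K| = ⌈n/2⌉`) is the inside of a placed listed graph. -/
theorem foolingMeasure_imp_manyRobustHalfTypes
    (hX1 : Summit.PneNP.PneNP.Theses.AeaCutRectangles.FoolingMeasure) (κ : ℕ) :
    ∃ᶠ n in Filter.atTop, ∀ 𝓛 : Finset (Finset (Sym2 (Fin n))), 𝓛.card ≤ 2 ^ (κ * n) →
      ∃ F : Finset (Sym2 (Fin n)), BisectionRobustCritical F ∧
        ∀ K : Finset (Fin n), K.card = (n + 1) / 2 → ∀ H ∈ 𝓛, ∀ σ : Equiv.Perm (Fin n),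
          bobSide K F ≠ bobSide K (relabel σ H) := by
  classical
  rw [Filter.frequently_atTop]
  intro N
  by_contra hcon
  push Not at hcon
  -- for every n ≥ N a small hitting list exists; below N take the full list
  let T : ℕ → ℕ := fun n => if N ≤ n then 2 ^ (κ * n) else Fintype.card (Finset (Sym2 (Fin n)))
  have hT : RobustHalfTypeBound T := by
    intro n
    by_cases hn : N ≤ n
    · obtain ⟨𝓛, hc, hall⟩ := hcon n hn
      exact ⟨𝓛, by simp [T, hn, hc], hall⟩
    · obtain ⟨K, -, hK⟩ := exists_subset_card_eq (s := (univ : Finset (Fin n)))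
        (show (n + 1) / 2 ≤ (univ : Finset (Fin n)).card by rw [card_univ, Fintype.card_fin]; omega)
      refine ⟨univ, by simp [T, hn], fun F _ => ⟨K, hK, F, mem_univ _, Equiv.refl _, ?_⟩⟩
      rw [relabel_refl]
  have hκ : ∀ᶠ n in Filter.atTop, T n ≤ 2 ^ (κ * n) :=
    Filter.eventually_atTop.2 ⟨N, fun n hn => by simp [T, hn]⟩
  exact foolingMeasure_false_of_fewRobustHalfTypes hT hκ hX1

/-! ### §5  g14's `RigidCoreLocalization` kills X1 for EVERY fringe fraction `δ < 1/2` -/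

/-- RIGID-CORE LOCALIZATION (restated verbatim from `ToftSeam.lean` §5, ns `…P4g14`, not importable): eventually every
bisection-robust 4-critical `F` over `Fin N` agrees, off a fringe `R` of `≤ δN` vertices, with a placed copy of one of
`≤ 2^{κN}` listed cores. -/
def RigidCoreLocalization (κ δ : ℝ) : Prop :=
  ∀ᶠ N : ℕ in Filter.atTop, ∃ 𝓒 : Finset (Finset (Sym2 (Fin N))), (𝓒.card : ℝ) ≤ (2 : ℝ) ^ (κ * N) ∧
    ∀ F : Finset (Sym2 (Fin N)), BisectionRobustCritical F →
      ∃ C ∈ 𝓒, ∃ σ : Equiv.Perm (Fin N), ∃ R : Finset (Fin N), (R.card : ℝ) ≤ δ * N ∧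
        ∀ e, e ∈ F ∧ (∀ x ∈ e, x ∉ R) ↔ e ∈ relabel σ C ∧ (∀ x ∈ e, x ∉ R)

/-- **`RigidCoreLocalization κ δ ⇒ ¬X1` for every `δ < 1/2`** (g14 §5 claimed usefulness only for `δ < ε`).  Bob takes
his `⌈n/2⌉`-half inside the complement of the fringe (`exists_half_avoiding`); there `F` IS the placed listed core, so
the localization list is a half-type hitting list and `false_of_halfCover` applies with `⌈κ⌉₊ + 6`. -/
theorem foolingMeasure_false_of_rigidCoreLocalization {κ δ : ℝ} (hδ : δ < 1 / 2)
    (h : RigidCoreLocalization κ δ) : ¬ Summit.PneNP.PneNP.Theses.AeaCutRectangles.FoolingMeasure := by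
  intro hX1
  obtain ⟨N₁, hN₁⟩ := Filter.eventually_atTop.1 h
  set κ' : ℕ := ⌈κ⌉₊ with hκ'
  obtain ⟨n, hnN, hn2, μ, hμ, hsum, hs, hX⟩ := foolingMeasure_schedule hX1 (κ' + 6) N₁
  obtain ⟨𝓒, hcard, hloc⟩ := hN₁ n hnN
  have hcardN : 𝓒.card ≤ 2 ^ (κ' * n) := by
    have h1 : (2 : ℝ) ^ (κ * n) ≤ (2 : ℝ) ^ ((κ' : ℝ) * n) := by
      apply Real.rpow_le_rpow_of_exponent_le (by norm_num)
      exact mul_le_mul_of_nonneg_right (Nat.le_ceil κ) (Nat.cast_nonneg n)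
    have h2 : ((𝓒.card : ℕ) : ℝ) ≤ ((2 ^ (κ' * n) : ℕ) : ℝ) := by
      calc ((𝓒.card : ℕ) : ℝ) ≤ (2 : ℝ) ^ (κ * n) := hcard
        _ ≤ (2 : ℝ) ^ ((κ' : ℝ) * n) := h1
        _ = ((2 ^ (κ' * n) : ℕ) : ℝ) := by
            rw [show ((κ' : ℝ) * n) = ((κ' * n : ℕ) : ℝ) by push_cast; ring, Real.rpow_natCast]
            norm_cast
    exact_mod_cast h2
  refine false_of_halfCover hn2 μ hμ hsum hs 𝓒 hcardN (fun S _ F _ hF => ?_) hX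
  obtain ⟨C, hC, σ, R, hRcard, hagree⟩ := hloc F hF
  have hR : 2 * R.card < n := by
    have hn0 : (0 : ℝ) < n := by exact_mod_cast (show 0 < n by omega)
    have hlt : (R.card : ℝ) < n / 2 := by
      calc (R.card : ℝ) ≤ δ * n := hRcard
        _ < 1 / 2 * n := mul_lt_mul_of_pos_right hδ hn0
        _ = n / 2 := by ring
    have h2 : ((2 * R.card : ℕ) : ℝ) < n := by push_cast; linarith
    exact_mod_cast h2
  obtain ⟨K, hKc, hEq⟩ := exists_half_avoiding hR hagree
  exact ⟨K, hKc, C, hC, σ, hEq⟩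

/-! ### §6  Fixed-base families (all seam designs over one base) are dead as X1 supports -/

/-- **FIXED-BASE FAMILIES.**  `n ≥ 1`, `κ`, `K₀` a vertex set of size `⌈n/2⌉`, `𝓗` a list of `≤ 2^{κn}` edge sets.
If every support graph of the probability measure `μ` (on loopless non-3-colourable edge sets) is a relabelling
`relabel τ G` of a graph `G` whose inside at `K₀` is listed (`G[K₀] ∈ 𝓗`), then X1's clause with `C = κ + 6` fails at
some cut of size `⌈n/2⌉`.  [Cover: `S = relabel τ G` lies in the Bob-superset rectangle of `(τ K₀, relabel τ G[K₀])`
— indeed `S[τK₀] = relabel τ G[K₀]` — a type duty of `𝓗` at `τK₀`; dictionary `≤ 2^n·|𝓗|·n^{⌈n/2⌉}`.]  Toft seams over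
one base `W` (`K₀ ⊆ V(W)`, `𝓗 = {(W - e₀)[K₀]}`, `κ = 0`): dead at `C = 6`, any mixture over attachments and labels. -/
theorem false_of_commonHalves {n κ : ℕ} (hn : 1 ≤ n) (μ : Finset (Sym2 (Fin n)) → ℝ)
    (hμ : ∀ S, 0 ≤ μ S) (hsum : ∑ S, μ S = 1)
    (hs : ∀ S, μ S ≠ 0 → (∀ e ∈ S, ¬ e.IsDiag) ∧ ¬ Col3 S)
    (K₀ : Finset (Fin n)) (hK₀ : K₀.card = (n + 1) / 2)
    (𝓗 : Finset (Finset (Sym2 (Fin n)))) (h𝓗 : 𝓗.card ≤ 2 ^ (κ * n))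
    (hsupp : ∀ S, μ S ≠ 0 → ∃ G : Finset (Sym2 (Fin n)), ∃ τ : Equiv.Perm (Fin n),
      S = relabel τ G ∧ bobSide K₀ G ∈ 𝓗)
    (hX : ∀ B : Finset (Fin n), n ≤ 2 * B.card → 2 * B.card ≤ n + 1 →
      RectClause μ B ((2 : ℝ) ^ (-((n : ℝ) / 2 * Real.logb 2 n) - ((κ + 6 : ℕ) : ℝ) * n))) : False := by
  classical
  set δ : ℝ := (2 : ℝ) ^ (-((n : ℝ) / 2 * Real.logb 2 n) - ((κ + 6 : ℕ) : ℝ) * n) with hδ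
  have hδpos : 0 < δ := Real.rpow_pos_of_pos (by norm_num) _
  set h : ℕ := (n + 1) / 2 with hh
  set Hset : Finset (Finset (Fin n)) := univ.filter (fun K => K.card = h) with hHset
  set I : Finset (Finset (Fin n) × Finset (Sym2 (Fin n))) := Hset.biUnion (fun K => typeDuties K 𝓗) with hI
  have hcov : ∀ S, μ S ≠ 0 → ∃ q ∈ I, q.2 ⊆ bobSide q.1 S ∧ ¬ Col3 (aliceSide q.1 S ∪ q.2) := by
    intro S hS
    obtain ⟨G, τ, hSG, hG⟩ := hsupp S hS
    have hK : (K₀.image τ).card = h := by rw [card_image_of_injective _ τ.injective, hK₀]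
    have hside : bobSide (K₀.image τ) S = relabel τ (bobSide K₀ G) := by
      rw [hSG]; exact bobSide_image_relabel τ K₀ G
    refine ⟨(K₀.image τ, relabel τ (bobSide K₀ G)), ?_, ?_, ?_⟩
    · rw [hI, mem_biUnion]
      refine ⟨K₀.image τ, mem_filter.2 ⟨mem_univ _, hK⟩, ?_⟩
      have hmem := mem_typeDuties (B := K₀.image τ) hG τ
      rwa [bobSide_image_relabel, bobSide_bobSide] at hmem
    · intro e he
      dsimp only at he ⊢
      rw [hside]
      exact he
    · dsimp only
      rw [← hside, aliceSide_union_bobSide]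
      exact (hs S hS).2
  have hcut : ∀ q ∈ I, n ≤ 2 * q.1.card ∧ 2 * q.1.card ≤ n + 1 := by
    intro q hq
    rw [hI, mem_biUnion] at hq
    obtain ⟨K, hK, hq⟩ := hq
    have hKc := (mem_filter.1 hK).2
    rw [typeDuties, mem_image] at hq
    obtain ⟨p', -, rfl⟩ := hq
    refine ⟨?_, ?_⟩ <;> · dsimp only; omega
  have htot : ∑ S, μ S ≤ (I.card : ℝ) * δ :=
    sum_le_card_mul_of_cover μ hμ hs I (fun q hq => hX q.1 (hcut q hq).1 (hcut q hq).2) hcov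
  rw [hsum] at htot
  have hIcard : I.card ≤ 2 ^ n * 𝓗.card * n ^ ((n + 1) / 2) := by
    have hHc : Hset.card ≤ 2 ^ n := by
      calc Hset.card ≤ (univ : Finset (Finset (Fin n))).card := card_le_card (filter_subset _ _)
        _ = 2 ^ n := by rw [card_univ, Fintype.card_finset, Fintype.card_fin]
    calc I.card ≤ ∑ K ∈ Hset, (typeDuties K 𝓗).card := card_biUnion_le
      _ ≤ ∑ K ∈ Hset, 𝓗.card * n ^ h := by
          refine sum_le_sum fun K hK => ?_
          have h1 := card_typeDuties_le K 𝓗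
          rw [(mem_filter.1 hK).2] at h1
          exact h1
      _ = Hset.card * (𝓗.card * n ^ h) := by rw [sum_const, smul_eq_mul]
      _ ≤ 2 ^ n * (𝓗.card * n ^ h) := Nat.mul_le_mul_right _ hHc
      _ = 2 ^ n * 𝓗.card * n ^ h := (Nat.mul_assoc _ _ _).symm
  have hIcardR : (I.card : ℝ) ≤ ((2 ^ n * 𝓗.card * n ^ ((n + 1) / 2) : ℕ) : ℝ) := by exact_mod_cast hIcard
  have htype : ((2 ^ n * 𝓗.card * n ^ ((n + 1) / 2) : ℕ) : ℝ) * δ ≤ 1 / 16 := halfType_term_le hn h𝓗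
  have := mul_le_mul_of_nonneg_right hIcardR hδpos.le
  linarith

/-! ### §7  Rigid Bob halves are affordable: ONE duty per (cut, partition) -/

section Rigid

variable {n : ℕ}

/-- The colourings inducing on `B` the same partition as `c₀`. -/
def samePartition (B : Finset (Fin n)) (c₀ : Fin n → Fin 3) : Set (Fin n → Fin 3) :=
  {c | ∀ x ∈ B, ∀ y ∈ B, c x = c y ↔ c₀ x = c₀ y}

/-- `G[B]` is RIGID ON `B` (witness `c₀`): `c₀` is proper on the edges of `G` inside `B`, and every colouring proper on
them induces `c₀`'s partition of `B` — unique 3-colourability of Bob's half as a labelled statement (it forces every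
vertex of `B` to be pinned by `G[B]`). -/
def RigidInside (B : Finset (Fin n)) (G : Finset (Sym2 (Fin n))) (c₀ : Fin n → Fin 3) : Prop :=
  c₀ ∉ killSet (bobSide B G) ∧ ∀ c : Fin n → Fin 3, c ∉ killSet (bobSide B G) → c ∈ samePartition B c₀

/-- A colouring with `c₀`'s partition on `B` is proper inside `B` as soon as `c₀` is. -/
theorem not_mem_killSet_bobSide_of_samePartition {B : Finset (Fin n)} {G : Finset (Sym2 (Fin n))}
    {c₀ c : Fin n → Fin 3} (h₀ : c₀ ∉ killSet (bobSide B G)) (hc : c ∈ samePartition B c₀) :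
    c ∉ killSet (bobSide B G) := by
  rintro ⟨e, he, hd, hm⟩
  obtain ⟨-, hin⟩ := mem_bobSide.1 he
  apply h₀
  refine ⟨e, he, hd, ?_⟩
  revert hd hm hin
  induction e using Sym2.ind with
  | h a b =>
    intro hd hm hin
    rw [map_mk_isDiag_iff] at hm ⊢
    exact (hc a (hin a (Sym2.mem_mk_left a b)) b (hin b (Sym2.mem_mk_right a b))).1 hm

/-- **Rigid halves lie in ONE duty rectangle per (cut, partition)**: a loopless non-3-colourable `G` with `G[B]` rigid
on `B` (witness `c₀`) lies in `dutyRect B (samePartition B c₀)ᶜ`. -/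
theorem mem_dutyRect_of_rigidInside {B : Finset (Fin n)} {G : Finset (Sym2 (Fin n))} {c₀ : Fin n → Fin 3}
    (hl : ∀ e ∈ G, ¬ e.IsDiag) (hG : ¬ Col3 G) (hrig : RigidInside B G c₀) :
    G ∈ dutyRect B (samePartition B c₀)ᶜ := by
  refine ⟨hl, fun c hc => ?_, fun c hc => ?_⟩
  · -- `c` outside the partition class is improper inside `B` (rigidity): an inside edge kills it
    have hkill : c ∈ killSet (bobSide B G) := by
      by_contra hnot
      exact (Set.mem_compl_iff _ _).1 hc (hrig.2 c hnot)
    obtain ⟨e, he, -, hm⟩ := hkill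
    obtain ⟨heG, hin⟩ := mem_bobSide.1 he
    exact ⟨e, heG, hin, hm⟩
  · -- `c` in the class is proper inside `B`; `G` is dark, so an edge meeting `V ∖ B` kills it
    have hc' : c ∈ samePartition B c₀ := by
      by_contra h'
      exact hc (Set.mem_compl h')
    have hprop := not_mem_killSet_bobSide_of_samePartition hrig.1 hc'
    obtain ⟨e, heG, hd, hm⟩ := (not_colorable_iff_forall_mem_killSet G).1 hG c
    refine ⟨e, heG, ?_, hm⟩
    by_contra hout
    push Not at hout
    exact hprop ⟨e, mem_bobSide.2 ⟨heG, hout⟩, hd, hm⟩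

/-- **RIGID HALVES ARE AFFORDABLE.**  For every `n ≥ 1` and `C ≥ 3`: no probability measure on loopless non-3-colourable
edge sets over `Fin n`, every support graph of which has a cut `B` of size `⌈n/2⌉` (or `n/2`) with `S[B]` rigid on `B`,
obeys X1's clause with bound `2^{-(n/2)log₂ n - Cn}` at those cuts: the dictionary `{(B, (samePartition B c₀)ᶜ)}` has
`≤ 2^n·3^n` duties, and `6^n · n^{-n/2} · 2^{-3n} ≤ (3/4)^n < 1`.  (The typed «R9, Bob side» of ARC-SANDWICH-r2s1g13:
rigid halves of ANY number of isomorphism types cost nothing.) -/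
theorem false_of_rigidHalves (hn : 1 ≤ n) (μ : Finset (Sym2 (Fin n)) → ℝ)
    (hμ : ∀ S, 0 ≤ μ S) (hsum : ∑ S, μ S = 1)
    (hs : ∀ S, μ S ≠ 0 → (∀ e ∈ S, ¬ e.IsDiag) ∧ ¬ Col3 S)
    (hrig : ∀ S, μ S ≠ 0 → ∃ B : Finset (Fin n), (n ≤ 2 * B.card ∧ 2 * B.card ≤ n + 1) ∧
      ∃ c₀ : Fin n → Fin 3, RigidInside B S c₀)
    {C : ℕ} (hC : 3 ≤ C)
    (hX : ∀ B : Finset (Fin n), n ≤ 2 * B.card → 2 * B.card ≤ n + 1 →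
      RectClause μ B ((2 : ℝ) ^ (-((n : ℝ) / 2 * Real.logb 2 n) - ((C : ℕ) : ℝ) * n))) : False := by
  classical
  set δ : ℝ := (2 : ℝ) ^ (-((n : ℝ) / 2 * Real.logb 2 n) - ((C : ℕ) : ℝ) * n) with hδ
  have hδpos : 0 < δ := Real.rpow_pos_of_pos (by norm_num) _
  set Wset : Finset (Finset (Fin n)) := univ.filter (fun B => n ≤ 2 * B.card ∧ 2 * B.card ≤ n + 1) with hW
  set J : Finset (Finset (Fin n) × (Fin n → Fin 3)) := Wset ×ˢ univ with hJ
  let p : Finset (Fin n) × (Fin n → Fin 3) → Finset (Sym2 (Fin n)) → Prop := fun q S =>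
    S ∈ dutyRect q.1 (samePartition q.1 q.2)ᶜ
  have hcov : ∀ S, μ S ≠ 0 → ∃ q ∈ J, p q S := by
    intro S hS
    obtain ⟨B, hB, c₀, hr⟩ := hrig S hS
    exact ⟨(B, c₀), mem_product.2 ⟨mem_filter.2 ⟨mem_univ _, hB⟩, mem_univ _⟩,
      mem_dutyRect_of_rigidInside (hs S hS).1 (hs S hS).2 hr⟩
  have htot : ∑ S, μ S ≤ (J.card : ℝ) * δ := by
    calc ∑ S, μ S ≤ ∑ q ∈ J, ∑ S ∈ univ.filter (p q), μ S := sum_le_sum_cover J p μ hμ hcov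
      _ ≤ ∑ _q ∈ J, δ := by
          refine sum_le_sum fun q hq => ?_
          obtain ⟨hB, -⟩ := mem_product.1 hq
          obtain ⟨h1, h2⟩ := (mem_filter.1 hB).2
          have hfs : univ.filter (p q) = dutyFinset q.1 (samePartition q.1 q.2)ᶜ := by
            ext S
            rw [mem_filter, mem_dutyFinset]
            simp [p]
          rw [hfs]
          exact dutySum_le_of_rectClause μ hμ (hX q.1 h1 h2) _
      _ = (J.card : ℝ) * δ := by rw [sum_const, nsmul_eq_mul]
  rw [hsum] at htot
  have hJ' : J.card ≤ 2 ^ n * 3 ^ n := by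
    have hWc : Wset.card ≤ 2 ^ n := by
      calc Wset.card ≤ (univ : Finset (Finset (Fin n))).card := card_le_card (filter_subset _ _)
        _ = 2 ^ n := by rw [card_univ, Fintype.card_finset, Fintype.card_fin]
    rw [hJ, card_product, card_univ, Fintype.card_fun, Fintype.card_fin, Fintype.card_fin]
    exact Nat.mul_le_mul_right _ hWc
  -- δ ≤ 2^{-3n} and 6^n · 2^{-3n} = (3/4)^n < 1
  have hδle : δ ≤ ((2 : ℝ) ^ (3 * n))⁻¹ := by
    rw [hδ, delta_eq hn]
    have hA : (1 : ℝ) ≤ (n : ℝ) ^ ((n : ℝ) / 2) := Real.one_le_rpow (by exact_mod_cast hn) (by positivity)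
    have hB : (2 : ℝ) ^ (3 * n) ≤ (2 : ℝ) ^ (C * n) :=
      pow_le_pow_right₀ (by norm_num) (Nat.mul_le_mul_right _ hC)
    calc ((n : ℝ) ^ ((n : ℝ) / 2))⁻¹ * ((2 : ℝ) ^ (C * n))⁻¹ ≤ 1 * ((2 : ℝ) ^ (3 * n))⁻¹ :=
          mul_le_mul (inv_le_one_of_one_le₀ hA) (inv_anti₀ (by positivity) hB) (by positivity) (by norm_num)
      _ = ((2 : ℝ) ^ (3 * n))⁻¹ := one_mul _
  have hlt : (J.card : ℝ) * δ < 1 := by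
    have hJR : (J.card : ℝ) ≤ (2 : ℝ) ^ n * 3 ^ n := by exact_mod_cast hJ'
    calc (J.card : ℝ) * δ ≤ ((2 : ℝ) ^ n * 3 ^ n) * ((2 : ℝ) ^ (3 * n))⁻¹ :=
          mul_le_mul hJR hδle hδpos.le (by positivity)
      _ = (3 / 4 : ℝ) ^ n := by
          rw [pow_mul, ← mul_pow, ← div_eq_mul_inv, ← div_pow]
          norm_num
      _ < 1 := pow_lt_one₀ (by norm_num) (by norm_num) (by omega)
  linarith

end Rigid

/-! ### §8  The MIXED floor: a rigid sub-core plus at most `n/2` floppy edges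

The two structural instances so far — a SPARSE near-half (`HalfSparseCore`, p570033: Bob's datum is a set of
`≤ n/2` edges) and a RIGID near-half (§7: Bob's datum is a partition) — are the two ends of one dictionary: Bob
announces a partition on a SUB-CORE `R ⊆ B` that the inside forces, plus the FLOPPY edges (those not inside `R`)
explicitly.  Cost `2^n · 2^n · 3^n · #{β : |β| ≤ n/2}`; affordable at `C ≥ 7`.  So X1 needs support cores with MORE
THAN `n/2` FLOPPY EDGES — edges outside every forced-partition sub-core — in EVERY near-half. -/

section Mixed

variable {n : ℕ}

/-- `F[B]` is CORE-RIGID on the sub-core `R` (witness `c₀`): `c₀` is proper on the edges of `F` inside `R`, and every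
colouring proper on the edges of `F` inside `B` induces `c₀`'s partition on `R`.  `R = B` is `RigidInside`
(`coreRigidInside_self`); `R = ∅` is no condition (`coreRigidInside_empty`).  (A satisfiable instance has `R ⊆ B` and
no vertex of `R` isolated in `F[B]`; nothing requires it.) -/
def CoreRigidInside (B R : Finset (Fin n)) (F : Finset (Sym2 (Fin n))) (c₀ : Fin n → Fin 3) : Prop :=
  c₀ ∉ killSet (bobSide R F) ∧ ∀ c : Fin n → Fin 3, c ∉ killSet (bobSide B F) → c ∈ samePartition R c₀

/-- `R = B`: core-rigidity is rigidity of the half. -/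
theorem coreRigidInside_self {B : Finset (Fin n)} {F : Finset (Sym2 (Fin n))} {c₀ : Fin n → Fin 3} :
    CoreRigidInside B B F c₀ ↔ RigidInside B F c₀ := Iff.rfl

/-- `R = ∅`: no condition. -/
theorem coreRigidInside_empty (B : Finset (Fin n)) (F : Finset (Sym2 (Fin n))) (c₀ : Fin n → Fin 3) :
    CoreRigidInside B ∅ F c₀ := by
  refine ⟨?_, fun c _ x hx => absurd hx (Finset.notMem_empty x)⟩
  rintro ⟨e, he, -, -⟩
  obtain ⟨-, hin⟩ := mem_bobSide.1 he
  induction e using Sym2.ind with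
  | h a b => exact absurd (hin a (Sym2.mem_mk_left a b)) (Finset.notMem_empty a)

/-- **The mixed duty covers.**  `G` loopless, `F ⊆ G` not 3-colourable, `F[B]` core-rigid on `R` (witness `c₀`),
`β ⊆ G[B]` a set of inside edges with `F[B] ⊆ F[R] ∪ β`.  Then `G` lies in the duty rectangle of
`Φ = (samePartition R c₀)ᶜ ∪ killSet β` over `B`: Bob kills every colouring off the partition (core-rigidity, through
`F[B] ⊆ G[B]`) and every colouring monochromatic on a floppy edge; Alice kills every colouring on the partition and
proper on `β` — such a colouring is proper on `F[R]` (it has `c₀`'s partition there) and on `β`, hence on `F[B]`, so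
darkness of `F` puts its monochromatic `F`-edge across the cut. -/
theorem mem_dutyRect_of_coreRigidInside {B R : Finset (Fin n)} {G F β : Finset (Sym2 (Fin n))}
    {c₀ : Fin n → Fin 3} (hl : ∀ e ∈ G, ¬ e.IsDiag) (hFG : F ⊆ G) (hF : ¬ Col3 F)
    (hrig : CoreRigidInside B R F c₀) (hβG : β ⊆ bobSide B G) (hcover : bobSide B F ⊆ bobSide R F ∪ β) :
    G ∈ dutyRect B ((samePartition R c₀)ᶜ ∪ killSet β) := by
  refine ⟨hl, fun c hc => ?_, fun c hc => ?_⟩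
  · rcases (Set.mem_union _ _ _).1 hc with hc | hc
    · -- off the partition on `R`: improper on `F[B] ⊆ G[B]`
      have hkill : c ∈ killSet (bobSide B F) := by
        by_contra hnot
        exact (Set.mem_compl_iff _ _).1 hc (hrig.2 c hnot)
      obtain ⟨e, he, -, hm⟩ := hkill
      obtain ⟨heF, hin⟩ := mem_bobSide.1 he
      exact ⟨e, hFG heF, hin, hm⟩
    · -- monochromatic on a floppy edge `e ∈ β ⊆ G[B]`
      obtain ⟨e, he, -, hm⟩ := hc
      obtain ⟨heG, hin⟩ := mem_bobSide.1 (hβG he)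
      exact ⟨e, heG, hin, hm⟩
  · -- on the partition and proper on `β`: proper on `F[B]`, so `F`'s monochromatic edge crosses the cut
    have hcR : c ∈ samePartition R c₀ := by
      by_contra h'
      exact hc (Set.mem_union_left _ (Set.mem_compl h'))
    have hcβ : c ∉ killSet β := fun h' => hc (Set.mem_union_right _ h')
    obtain ⟨e, heF, hd, hm⟩ := (not_colorable_iff_forall_mem_killSet F).1 hF c
    refine ⟨e, hFG heF, ?_, hm⟩
    by_contra hout
    push Not at hout
    have he : e ∈ bobSide B F := mem_bobSide.2 ⟨heF, hout⟩
    rcases mem_union.1 (hcover he) with heR | heβ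
    · exact not_mem_killSet_bobSide_of_samePartition hrig.1 hcR ⟨e, heR, hd, hm⟩
    · exact hcβ ⟨e, heβ, hd, hm⟩

/-- The mixed count beats the threshold at `C ≥ 7`:
`(2^n · 2^n · 3^n · (n/2+1) · C(N₂, n/2)) · δ_C < 1`  (`= 6^n·2^{-(C-4)n} · [2^n (n/2+1) C(N₂,n/2) δ_4] < (3/4)^n · 1`). -/
theorem mixed_term_lt_one {n C : ℕ} (hn : 2 ≤ n) (hC : 7 ≤ C) :
    (((2 ^ n * 2 ^ n * 3 ^ n * ((n / 2 + 1) * (Fintype.card (Sym2 (Fin n))).choose (n / 2))) : ℕ) : ℝ) *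
      (2 : ℝ) ^ (-((n : ℝ) / 2 * Real.logb 2 n) - ((C : ℕ) : ℝ) * n) < 1 := by
  have hlt := halfSparse_count_lt_one hn
  have hsplit := @delta_split n C (by omega)
  have hδ4 : (0 : ℝ) < (2 : ℝ) ^ (-((n : ℝ) / 2 * Real.logb 2 n) - ((4 : ℕ) : ℝ) * n) :=
    Real.rpow_pos_of_pos (by norm_num) _
  have hE : (2 : ℝ) ^ n * 3 ^ n ≤ (2 : ℝ) ^ ((C - 4) * n) := by
    calc (2 : ℝ) ^ n * 3 ^ n = 6 ^ n := by rw [← mul_pow]; norm_num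
      _ ≤ 8 ^ n := pow_le_pow_left₀ (by norm_num) (by norm_num) n
      _ = 2 ^ (3 * n) := by rw [pow_mul]; norm_num
      _ ≤ 2 ^ ((C - 4) * n) := pow_le_pow_right₀ (by norm_num) (Nat.mul_le_mul_right _ (by omega))
  have hEpos : (0 : ℝ) < (2 : ℝ) ^ ((C - 4) * n) := by positivity
  have hb : (2 : ℝ) ^ n * 3 ^ n * ((2 : ℝ) ^ ((C - 4) * n))⁻¹ ≤ 1 := by
    rw [mul_inv_le_iff₀ hEpos, one_mul]; exact hE
  have ha : (0 : ℝ) ≤ ((2 ^ n : ℕ) : ℝ) *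
      ((((n / 2 + 1) * (Fintype.card (Sym2 (Fin n))).choose (n / 2) : ℕ) : ℝ) *
        (2 : ℝ) ^ (-((n : ℝ) / 2 * Real.logb 2 n) - ((4 : ℕ) : ℝ) * n)) :=
    mul_nonneg (by positivity) (mul_nonneg (by positivity) hδ4.le)
  have hcast : (((2 ^ n * 2 ^ n * 3 ^ n * ((n / 2 + 1) * (Fintype.card (Sym2 (Fin n))).choose (n / 2))) : ℕ) : ℝ)
      = ((2 ^ n : ℕ) : ℝ) * ((((n / 2 + 1) * (Fintype.card (Sym2 (Fin n))).choose (n / 2) : ℕ) : ℝ)) *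
          ((2 : ℝ) ^ n * 3 ^ n) := by
    push_cast; ring
  rw [hcast, hsplit]
  calc ((2 ^ n : ℕ) : ℝ) * ((((n / 2 + 1) * (Fintype.card (Sym2 (Fin n))).choose (n / 2) : ℕ) : ℝ)) *
        ((2 : ℝ) ^ n * 3 ^ n) *
        ((2 : ℝ) ^ (-((n : ℝ) / 2 * Real.logb 2 n) - ((4 : ℕ) : ℝ) * n) * ((2 : ℝ) ^ ((C - 4) * n))⁻¹)
      = (((2 ^ n : ℕ) : ℝ) * ((((n / 2 + 1) * (Fintype.card (Sym2 (Fin n))).choose (n / 2) : ℕ) : ℝ) *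
          (2 : ℝ) ^ (-((n : ℝ) / 2 * Real.logb 2 n) - ((4 : ℕ) : ℝ) * n))) *
          ((2 : ℝ) ^ n * 3 ^ n * ((2 : ℝ) ^ ((C - 4) * n))⁻¹) := by ring
    _ < 1 := mul_lt_one_of_nonneg_of_lt_one_left ha hlt hb

/-- **MIXED HALVES ARE AFFORDABLE.**  For every `n ≥ 2` and `C ≥ 7`: no probability measure on loopless non-3-colourable
edge sets over `Fin n`, every support graph `S` of which contains a non-3-colourable `F ⊆ S` with a near-half cut `B`,
a sub-core `R`, a witness `c₀` with `F[B]` core-rigid on `R`, and a floppy set `β ⊆ F[B]` of `≤ n/2` edges with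
`F[B] ⊆ F[R] ∪ β`, obeys X1's clause with bound `2^{-(n/2)log₂ n - Cn}` at the near-half cuts.  `R = ∅, β = F[B]`
is `HalfSparseCore`; `R = B, β = ∅` is `false_of_rigidHalves` (up to the constant). -/
theorem false_of_mixedHalves (hn : 2 ≤ n) (μ : Finset (Sym2 (Fin n)) → ℝ)
    (hμ : ∀ S, 0 ≤ μ S) (hsum : ∑ S, μ S = 1)
    (hs : ∀ S, μ S ≠ 0 → (∀ e ∈ S, ¬ e.IsDiag) ∧ ¬ Col3 S)
    (hmix : ∀ S, μ S ≠ 0 → ∃ F ⊆ S, ¬ Col3 F ∧ ∃ B : Finset (Fin n), (n ≤ 2 * B.card ∧ 2 * B.card ≤ n + 1) ∧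
      ∃ R : Finset (Fin n), ∃ c₀ : Fin n → Fin 3, CoreRigidInside B R F c₀ ∧
        ∃ β ⊆ bobSide B F, β.card ≤ n / 2 ∧ bobSide B F ⊆ bobSide R F ∪ β)
    {C : ℕ} (hC : 7 ≤ C)
    (hX : ∀ B : Finset (Fin n), n ≤ 2 * B.card → 2 * B.card ≤ n + 1 →
      RectClause μ B ((2 : ℝ) ^ (-((n : ℝ) / 2 * Real.logb 2 n) - ((C : ℕ) : ℝ) * n))) : False := by
  classical
  set δ : ℝ := (2 : ℝ) ^ (-((n : ℝ) / 2 * Real.logb 2 n) - ((C : ℕ) : ℝ) * n) with hδ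
  have hδpos : 0 < δ := Real.rpow_pos_of_pos (by norm_num) _
  set m : ℕ := n / 2 with hm
  set Wset : Finset (Finset (Fin n)) := univ.filter (fun B => n ≤ 2 * B.card ∧ 2 * B.card ≤ n + 1) with hW
  set P : Finset (Finset (Sym2 (Fin n))) := univ.filter (fun s => s.card ≤ m) with hP
  set J : Finset (Finset (Fin n) × (Finset (Fin n) × ((Fin n → Fin 3) × Finset (Sym2 (Fin n))))) :=
    Wset ×ˢ ((univ : Finset (Finset (Fin n))) ×ˢ ((univ : Finset (Fin n → Fin 3)) ×ˢ P)) with hJ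
  let p : Finset (Fin n) × (Finset (Fin n) × ((Fin n → Fin 3) × Finset (Sym2 (Fin n)))) →
      Finset (Sym2 (Fin n)) → Prop :=
    fun q S => S ∈ dutyRect q.1 ((samePartition q.2.1 q.2.2.1)ᶜ ∪ killSet q.2.2.2)
  have hcov : ∀ S, μ S ≠ 0 → ∃ q ∈ J, p q S := by
    intro S hS
    obtain ⟨F, hFS, hF, B, hB, R, c₀, hrig, β, hβ, hβc, hcover⟩ := hmix S hS
    refine ⟨(B, R, c₀, β), ?_, ?_⟩
    · exact mem_product.2 ⟨mem_filter.2 ⟨mem_univ _, hB⟩, mem_product.2 ⟨mem_univ _,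
        mem_product.2 ⟨mem_univ _, mem_filter.2 ⟨mem_univ _, by simpa [hm] using hβc⟩⟩⟩⟩
    · exact mem_dutyRect_of_coreRigidInside (hs S hS).1 hFS hF hrig (hβ.trans (bobSide_mono B hFS)) hcover
  have htot : ∑ S, μ S ≤ (J.card : ℝ) * δ := by
    calc ∑ S, μ S ≤ ∑ q ∈ J, ∑ S ∈ univ.filter (p q), μ S := sum_le_sum_cover J p μ hμ hcov
      _ ≤ ∑ _q ∈ J, δ := by
          refine sum_le_sum fun q hq => ?_
          obtain ⟨hB, -⟩ := mem_product.1 hq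
          obtain ⟨h1, h2⟩ := (mem_filter.1 hB).2
          have hfs : univ.filter (p q) =
              dutyFinset q.1 ((samePartition q.2.1 q.2.2.1)ᶜ ∪ killSet q.2.2.2) := by
            ext S
            rw [mem_filter, mem_dutyFinset]
            simp [p]
          rw [hfs]
          exact dutySum_le_of_rectClause μ hμ (hX q.1 h1 h2) _
      _ = (J.card : ℝ) * δ := by rw [sum_const, nsmul_eq_mul]
  rw [hsum] at htot
  have hJ' : J.card ≤ 2 ^ n * 2 ^ n * 3 ^ n * ((n / 2 + 1) * (Fintype.card (Sym2 (Fin n))).choose (n / 2)) := by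
    have hWc : Wset.card ≤ 2 ^ n := by
      calc Wset.card ≤ (univ : Finset (Finset (Fin n))).card := card_le_card (filter_subset _ _)
        _ = 2 ^ n := by rw [card_univ, Fintype.card_finset, Fintype.card_fin]
    have hPc : P.card ≤ (n / 2 + 1) * (Fintype.card (Sym2 (Fin n))).choose (n / 2) :=
      card_filter_card_le_choose (Sym2 (Fin n)) m
        ((show 2 * m ≤ n by omega).trans (le_card_sym2_fin (by omega)))
    have hJc : J.card = Wset.card * (2 ^ n * (3 ^ n * P.card)) := by
      rw [hJ]
      simp only [card_product, card_univ, Fintype.card_finset, Fintype.card_fun, Fintype.card_fin]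
    rw [hJc]
    calc Wset.card * (2 ^ n * (3 ^ n * P.card))
        ≤ 2 ^ n * (2 ^ n * (3 ^ n * ((n / 2 + 1) * (Fintype.card (Sym2 (Fin n))).choose (n / 2)))) :=
          Nat.mul_le_mul hWc (Nat.mul_le_mul_left _ (Nat.mul_le_mul_left _ hPc))
      _ = 2 ^ n * 2 ^ n * 3 ^ n * ((n / 2 + 1) * (Fintype.card (Sym2 (Fin n))).choose (n / 2)) := by ring
  have hlt := mixed_term_lt_one hn hC
  have hJR : (J.card : ℝ) ≤
      (((2 ^ n * 2 ^ n * 3 ^ n * ((n / 2 + 1) * (Fintype.card (Sym2 (Fin n))).choose (n / 2))) : ℕ) : ℝ) := by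
    exact_mod_cast hJ'
  have := mul_le_mul_of_nonneg_right hJR hδpos.le
  linarith

/-- **MIXED HALF BOUND**: eventually every bisection-robust 4-edge-critical edge set `F` over `Fin n` has a near-half
cut `B`, a sub-core `R`, a witness `c₀` with `F[B]` core-rigid on `R`, and a floppy set `β ⊆ F[B]` of `≤ n/2` edges
with `F[B] ⊆ F[R] ∪ β`.  OPEN.  WHY IT MIGHT FAIL: planted-colouring-like 4-critical designs of average degree in the
window where every half spans `> n/2` edges yet no half has a forced-partition cluster capturing all but `n/2` of them. -/
def MixedHalfBound : Prop :=
  ∀ᶠ n in Filter.atTop, ∀ F : Finset (Sym2 (Fin n)), BisectionRobustCritical F →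
    ∃ B : Finset (Fin n), (n ≤ 2 * B.card ∧ 2 * B.card ≤ n + 1) ∧
      ∃ R : Finset (Fin n), ∃ c₀ : Fin n → Fin 3, CoreRigidInside B R F c₀ ∧
        ∃ β ⊆ bobSide B F, β.card ≤ n / 2 ∧ bobSide B F ⊆ bobSide R F ∪ β

/-- **`MixedHalfBound ⇒ ¬X1`** (at `C = 7`).  Non-robust critical cores need no hypothesis: a near-half inside their
sparse `≥ n/2`-set is the instance `R = ∅`, `β = F[B]`. -/
theorem foolingMeasure_false_of_mixedHalfBound (h : MixedHalfBound) :
    ¬ Summit.PneNP.PneNP.Theses.AeaCutRectangles.FoolingMeasure := by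
  classical
  intro hX1
  obtain ⟨N, hN⟩ := Filter.eventually_atTop.1 h
  obtain ⟨n, hnN, hn2, μ, hμ, hsum, hs, hX⟩ := foolingMeasure_schedule hX1 7 N
  refine false_of_mixedHalves hn2 μ hμ hsum hs (fun S hS => ?_) le_rfl hX
  obtain ⟨hl, hc⟩ := hs S hS
  have hF := core_critical S hl hc
  have hFS := core_subset S
  refine ⟨core S, hFS, hF.2.1, ?_⟩
  by_cases hrob : ∀ S' : Finset (Fin n), n ≤ 2 * S'.card → n < 2 * (bobSide S' (core S)).card
  · exact hN n hnN (core S) ⟨hF, hrob⟩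
  · push Not at hrob
    obtain ⟨S', hS', hcard⟩ := hrob
    obtain ⟨B, hBS', hBc⟩ := exists_subset_card_eq (show (n + 1) / 2 ≤ S'.card by omega)
    have hle : (bobSide B (core S)).card ≤ n / 2 := by
      have := card_le_card (bobSide_mono_left hBS' (core S))
      omega
    refine ⟨B, ⟨by rw [hBc]; omega, by rw [hBc]; omega⟩, ∅, fun _ => 0, coreRigidInside_empty B _ _,
      bobSide B (core S), subset_rfl, hle, subset_union_right⟩

/-- Kill path under the mixed half bound. -/
theorem noFoolingMeasure_of_mixedHalfBound (h : MixedHalfBound) :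
    Summit.PneNP.PneNP.Theses.AeaCutRectangles.NoFoolingMeasure :=
  foolingMeasure_false_of_mixedHalfBound h

/-- **The construct side's burden, sharpened: MORE THAN `n/2` FLOPPY EDGES IN EVERY NEAR-HALF.**  X1 forces, infinitely
often, a bisection-robust 4-edge-critical `F` such that in EVERY near-half `B`, for EVERY sub-core `R` on which `F[B]`
forces a partition, more than `n/2` edges of `F[B]` lie outside `F[R]`. -/
theorem foolingMeasure_imp_floppyHalves (hX1 : Summit.PneNP.PneNP.Theses.AeaCutRectangles.FoolingMeasure) :
    ∃ᶠ n in Filter.atTop, ∃ F : Finset (Sym2 (Fin n)), BisectionRobustCritical F ∧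
      ∀ B : Finset (Fin n), (n ≤ 2 * B.card ∧ 2 * B.card ≤ n + 1) →
        ∀ (R : Finset (Fin n)) (c₀ : Fin n → Fin 3), CoreRigidInside B R F c₀ →
          ∀ β ⊆ bobSide B F, bobSide B F ⊆ bobSide R F ∪ β → n / 2 < β.card := by
  by_contra hcon
  rw [Filter.not_frequently] at hcon
  have h : MixedHalfBound := by
    refine hcon.mono fun n hn F hF => ?_
    by_contra h'
    exact hn ⟨F, hF, fun B hB R c₀ hrig β hβ hcov => by
      by_contra hcard
      exact h' ⟨B, hB, R, c₀, hrig, β, hβ, Nat.le_of_not_lt hcard, hcov⟩⟩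
  exact foolingMeasure_false_of_mixedHalfBound h hX1

end Mixed

/-! ### §9  The MASTER floor: forced partition + (few explicit OR listed) floppy part

Join of §2 (lists) and §8 (forced partitions): Bob announces a forced partition on a sub-core `R` and, for the floppy
part `β` (`F[B] ⊆ F[R] ∪ β ⊆ F[B]`), EITHER its `≤ n/2` edges explicitly OR a placed listed graph equal to it.
Dictionary `≤ 12^n·((n/2+1)·C(N₂,n/2) + |𝓛|·n^{⌈n/2⌉})`, affordable at `C = κ + 9` when `|𝓛| ≤ 2^{κn}`.  The single
construct-side quantity left is the HITTING ENTROPY OF THE UNFORCED PART of every near-half. -/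

section Master

variable {n : ℕ}

/-- The X1 budget scales by `2^{-(C-C₀)n}` between constants `C₀ ≤ C`. -/
theorem delta_split' {n C₀ C : ℕ} (hC : C₀ ≤ C) :
    (2 : ℝ) ^ (-((n : ℝ) / 2 * Real.logb 2 n) - ((C : ℕ) : ℝ) * n) =
      (2 : ℝ) ^ (-((n : ℝ) / 2 * Real.logb 2 n) - ((C₀ : ℕ) : ℝ) * n) * ((2 : ℝ) ^ ((C - C₀) * n))⁻¹ := by
  have hC' : ((C : ℕ) : ℝ) = ((C₀ : ℕ) : ℝ) + ((C - C₀ : ℕ) : ℝ) := by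
    rw [← Nat.cast_add]; congr 1; omega
  rw [hC', add_mul, ← sub_sub, Real.rpow_sub (by norm_num) _ (((C - C₀ : ℕ) : ℝ) * n)]
  rw [div_eq_mul_inv]
  congr 2
  rw [show ((C - C₀ : ℕ) : ℝ) * (n : ℝ) = (((C - C₀) * n : ℕ) : ℝ) by push_cast; ring, Real.rpow_natCast]

/-- The mixed count at `C ≥ 8` is at most `1/2` of the threshold. -/
theorem mixed_term_le_half {n C : ℕ} (hn : 2 ≤ n) (hC : 8 ≤ C) :
    (((2 ^ n * 2 ^ n * 3 ^ n * ((n / 2 + 1) * (Fintype.card (Sym2 (Fin n))).choose (n / 2))) : ℕ) : ℝ) *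
      (2 : ℝ) ^ (-((n : ℝ) / 2 * Real.logb 2 n) - ((C : ℕ) : ℝ) * n) ≤ 1 / 2 := by
  have h7 := mixed_term_lt_one hn (show 7 ≤ 7 from le_rfl)
  have hsplit := @delta_split' n 7 C (by omega)
  have h12 : 1 * 2 ≤ (C - 7) * n := Nat.mul_le_mul (by omega) hn
  have hE : (2 : ℝ) ≤ (2 : ℝ) ^ ((C - 7) * n) := by
    calc (2 : ℝ) = 2 ^ 1 := by norm_num
      _ ≤ 2 ^ ((C - 7) * n) := pow_le_pow_right₀ (by norm_num) ((show 1 ≤ 1 * 2 by norm_num).trans h12)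
  have hEpos : (0 : ℝ) < (2 : ℝ) ^ ((C - 7) * n) := by positivity
  rw [hsplit, ← mul_assoc]
  calc _ ≤ 1 * (2 : ℝ)⁻¹ :=
        mul_le_mul h7.le (inv_anti₀ (by norm_num) hE) (inv_nonneg.2 hEpos.le) zero_le_one
    _ = 1 / 2 := by norm_num

/-- **MASTER COVER BOUND.**  `n ≥ 2`, `κ`, a list `𝓛` of `≤ 2^{κn}` edge sets; every support graph `S` contains a dark
`F ⊆ S` with a near-half cut `B`, a sub-core `R`, a witness `c₀` (`F[B]` core-rigid on `R`) and a sandwiched floppy set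
`F[B] ⊆ F[R] ∪ β`, `β ⊆ F[B]`, which is SMALL (`|β| ≤ n/2`) or LISTED (`β = (relabel σ H)[B]`, `H ∈ 𝓛`).  Then X1's
clause with `C = κ + 9` fails at some near-half cut. -/
theorem false_of_masterCover {κ : ℕ} (hn : 2 ≤ n) (μ : Finset (Sym2 (Fin n)) → ℝ)
    (hμ : ∀ S, 0 ≤ μ S) (hsum : ∑ S, μ S = 1)
    (hs : ∀ S, μ S ≠ 0 → (∀ e ∈ S, ¬ e.IsDiag) ∧ ¬ Col3 S)
    (𝓛 : Finset (Finset (Sym2 (Fin n)))) (h𝓛 : 𝓛.card ≤ 2 ^ (κ * n))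
    (hmaster : ∀ S, μ S ≠ 0 → ∃ F ⊆ S, ¬ Col3 F ∧ ∃ B : Finset (Fin n), (n ≤ 2 * B.card ∧ 2 * B.card ≤ n + 1) ∧
      ∃ R : Finset (Fin n), ∃ c₀ : Fin n → Fin 3, CoreRigidInside B R F c₀ ∧
        ∃ β ⊆ bobSide B F, bobSide B F ⊆ bobSide R F ∪ β ∧
          (β.card ≤ n / 2 ∨ ∃ H ∈ 𝓛, ∃ σ : Equiv.Perm (Fin n), β = bobSide B (relabel σ H)))
    (hX : ∀ B : Finset (Fin n), n ≤ 2 * B.card → 2 * B.card ≤ n + 1 →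
      RectClause μ B ((2 : ℝ) ^ (-((n : ℝ) / 2 * Real.logb 2 n) - ((κ + 9 : ℕ) : ℝ) * n))) : False := by
  classical
  set δ : ℝ := (2 : ℝ) ^ (-((n : ℝ) / 2 * Real.logb 2 n) - ((κ + 9 : ℕ) : ℝ) * n) with hδ
  have hδpos : 0 < δ := Real.rpow_pos_of_pos (by norm_num) _
  set m : ℕ := n / 2 with hm
  set h : ℕ := (n + 1) / 2 with hh
  set Wset : Finset (Finset (Fin n)) := univ.filter (fun B => n ≤ 2 * B.card ∧ 2 * B.card ≤ n + 1) with hW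
  set P : Finset (Finset (Sym2 (Fin n))) := univ.filter (fun s => s.card ≤ m) with hP
  let TB : Finset (Fin n) → Finset (Finset (Sym2 (Fin n))) := fun B => (typeDuties B 𝓛).image Prod.snd
  set JP : Finset (Finset (Fin n) × (Finset (Fin n) × ((Fin n → Fin 3) × Finset (Sym2 (Fin n))))) :=
    Wset ×ˢ ((univ : Finset (Finset (Fin n))) ×ˢ ((univ : Finset (Fin n → Fin 3)) ×ˢ P)) with hJP
  set JT : Finset (Finset (Fin n) × (Finset (Fin n) × ((Fin n → Fin 3) × Finset (Sym2 (Fin n))))) :=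
    Wset.biUnion (fun B => ((univ : Finset (Finset (Fin n))) ×ˢ ((univ : Finset (Fin n → Fin 3)) ×ˢ TB B)).image
      (fun r => (B, r))) with hJT
  set J := JP ∪ JT with hJ
  let p : Finset (Fin n) × (Finset (Fin n) × ((Fin n → Fin 3) × Finset (Sym2 (Fin n)))) →
      Finset (Sym2 (Fin n)) → Prop :=
    fun q S => S ∈ dutyRect q.1 ((samePartition q.2.1 q.2.2.1)ᶜ ∪ killSet q.2.2.2)
  -- cover
  have hcov : ∀ S, μ S ≠ 0 → ∃ q ∈ J, p q S := by
    intro S hS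
    obtain ⟨F, hFS, hF, B, hB, R, c₀, hrig, β, hβ, hcover, hsize⟩ := hmaster S hS
    refine ⟨(B, R, c₀, β), ?_,
      mem_dutyRect_of_coreRigidInside (hs S hS).1 hFS hF hrig (hβ.trans (bobSide_mono B hFS)) hcover⟩
    rw [hJ, mem_union]
    rcases hsize with hsmall | ⟨H, hH, σ, rfl⟩
    · left
      exact mem_product.2 ⟨mem_filter.2 ⟨mem_univ _, hB⟩, mem_product.2 ⟨mem_univ _,
        mem_product.2 ⟨mem_univ _, mem_filter.2 ⟨mem_univ _, by simpa [hm] using hsmall⟩⟩⟩⟩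
    · right
      rw [hJT, mem_biUnion]
      refine ⟨B, mem_filter.2 ⟨mem_univ _, hB⟩, mem_image.2 ⟨(R, c₀, bobSide B (relabel σ H)), ?_, rfl⟩⟩
      exact mem_product.2 ⟨mem_univ _, mem_product.2 ⟨mem_univ _,
        mem_image.2 ⟨(B, bobSide B (relabel σ H)), mem_typeDuties hH σ, rfl⟩⟩⟩
  -- every duty sits at a window cut
  have hcut : ∀ q ∈ J, n ≤ 2 * q.1.card ∧ 2 * q.1.card ≤ n + 1 := by
    intro q hq
    rw [hJ, mem_union] at hq
    rcases hq with hq | hq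
    · obtain ⟨hB, -⟩ := mem_product.1 hq
      exact (mem_filter.1 hB).2
    · rw [hJT, mem_biUnion] at hq
      obtain ⟨B, hB, hq⟩ := hq
      obtain ⟨r, -, rfl⟩ := mem_image.1 hq
      exact (mem_filter.1 hB).2
  -- union bound
  have htot : ∑ S, μ S ≤ (J.card : ℝ) * δ := by
    calc ∑ S, μ S ≤ ∑ q ∈ J, ∑ S ∈ univ.filter (p q), μ S := sum_le_sum_cover J p μ hμ hcov
      _ ≤ ∑ _q ∈ J, δ := by
          refine sum_le_sum fun q hq => ?_
          obtain ⟨h1, h2⟩ := hcut q hq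
          have hfs : univ.filter (p q) =
              dutyFinset q.1 ((samePartition q.2.1 q.2.2.1)ᶜ ∪ killSet q.2.2.2) := by
            ext S
            rw [mem_filter, mem_dutyFinset]
            simp [p]
          rw [hfs]
          exact dutySum_le_of_rectClause μ hμ (hX q.1 h1 h2) _
      _ = (J.card : ℝ) * δ := by rw [sum_const, nsmul_eq_mul]
  rw [hsum] at htot
  -- counts
  have hWc : Wset.card ≤ 2 ^ n := by
    calc Wset.card ≤ (univ : Finset (Finset (Fin n))).card := card_le_card (filter_subset _ _)
      _ = 2 ^ n := by rw [card_univ, Fintype.card_finset, Fintype.card_fin]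
  have hJP' : JP.card ≤ 2 ^ n * 2 ^ n * 3 ^ n * ((n / 2 + 1) * (Fintype.card (Sym2 (Fin n))).choose (n / 2)) := by
    have hPc : P.card ≤ (n / 2 + 1) * (Fintype.card (Sym2 (Fin n))).choose (n / 2) :=
      card_filter_card_le_choose (Sym2 (Fin n)) m
        ((show 2 * m ≤ n by omega).trans (le_card_sym2_fin (by omega)))
    have hJc : JP.card = Wset.card * (2 ^ n * (3 ^ n * P.card)) := by
      rw [hJP]
      simp only [card_product, card_univ, Fintype.card_finset, Fintype.card_fun, Fintype.card_fin]
    rw [hJc]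
    calc Wset.card * (2 ^ n * (3 ^ n * P.card))
        ≤ 2 ^ n * (2 ^ n * (3 ^ n * ((n / 2 + 1) * (Fintype.card (Sym2 (Fin n))).choose (n / 2)))) :=
          Nat.mul_le_mul hWc (Nat.mul_le_mul_left _ (Nat.mul_le_mul_left _ hPc))
      _ = 2 ^ n * 2 ^ n * 3 ^ n * ((n / 2 + 1) * (Fintype.card (Sym2 (Fin n))).choose (n / 2)) := by ring
  have hJT' : JT.card ≤ 2 ^ n * 3 ^ n * (2 ^ n * 𝓛.card * n ^ h) := by
    have hTB : ∀ B ∈ Wset, (TB B).card ≤ 𝓛.card * n ^ h := by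
      intro B hB
      obtain ⟨-, h2⟩ := (mem_filter.1 hB).2
      calc (TB B).card ≤ (typeDuties B 𝓛).card := card_image_le
        _ ≤ 𝓛.card * n ^ B.card := card_typeDuties_le B 𝓛
        _ ≤ 𝓛.card * n ^ h := Nat.mul_le_mul_left _ (Nat.pow_le_pow_right (by omega) (by omega))
    calc JT.card ≤ ∑ B ∈ Wset, (((univ : Finset (Finset (Fin n))) ×ˢ
          ((univ : Finset (Fin n → Fin 3)) ×ˢ TB B)).image (fun r => (B, r))).card := by
          rw [hJT]; exact card_biUnion_le
      _ ≤ ∑ B ∈ Wset, 2 ^ n * (3 ^ n * (𝓛.card * n ^ h)) := by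
          refine sum_le_sum fun B hB => card_image_le.trans ?_
          simp only [card_product, card_univ, Fintype.card_finset, Fintype.card_fun, Fintype.card_fin]
          exact Nat.mul_le_mul_left _ (Nat.mul_le_mul_left _ (hTB B hB))
      _ = Wset.card * (2 ^ n * (3 ^ n * (𝓛.card * n ^ h))) := by rw [sum_const, smul_eq_mul]
      _ ≤ 2 ^ n * (2 ^ n * (3 ^ n * (𝓛.card * n ^ h))) := Nat.mul_le_mul_right _ hWc
      _ = 2 ^ n * 3 ^ n * (2 ^ n * 𝓛.card * n ^ h) := by ring
  -- the two terms against the threshold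
  have hP_le : (((2 ^ n * 2 ^ n * 3 ^ n * ((n / 2 + 1) * (Fintype.card (Sym2 (Fin n))).choose (n / 2))) : ℕ) : ℝ)
      * δ ≤ 1 / 2 := mixed_term_le_half hn (by omega)
  have hT_le : (((2 ^ n * 3 ^ n * (2 ^ n * 𝓛.card * n ^ h)) : ℕ) : ℝ) * δ ≤ 1 / 16 := by
    have h6 := halfType_term_le (show 1 ≤ n by omega) h𝓛
    have hsplit := @delta_split' n (κ + 6) (κ + 9) (by omega)
    rw [show κ + 9 - (κ + 6) = 3 by omega] at hsplit
    have hE : (2 : ℝ) ^ n * 3 ^ n ≤ (2 : ℝ) ^ (3 * n) := by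
      calc (2 : ℝ) ^ n * 3 ^ n = 6 ^ n := by rw [← mul_pow]; norm_num
        _ ≤ 8 ^ n := pow_le_pow_left₀ (by norm_num) (by norm_num) n
        _ = 2 ^ (3 * n) := by rw [pow_mul]; norm_num
    have hEpos : (0 : ℝ) < (2 : ℝ) ^ (3 * n) := by positivity
    have hb : (2 : ℝ) ^ n * 3 ^ n * ((2 : ℝ) ^ (3 * n))⁻¹ ≤ 1 := by
      rw [mul_inv_le_iff₀ hEpos, one_mul]; exact hE
    have hδ6 : (0 : ℝ) ≤ (2 : ℝ) ^ (-((n : ℝ) / 2 * Real.logb 2 n) - ((κ + 6 : ℕ) : ℝ) * n) :=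
      (Real.rpow_pos_of_pos (by norm_num) _).le
    have hcast : (((2 ^ n * 3 ^ n * (2 ^ n * 𝓛.card * n ^ h)) : ℕ) : ℝ) =
        ((2 : ℝ) ^ n * 3 ^ n) * (((2 ^ n * 𝓛.card * n ^ h : ℕ)) : ℝ) := by push_cast; ring
    rw [hcast, hδ, hsplit]
    calc (2 : ℝ) ^ n * 3 ^ n * (((2 ^ n * 𝓛.card * n ^ h : ℕ)) : ℝ) *
          ((2 : ℝ) ^ (-((n : ℝ) / 2 * Real.logb 2 n) - ((κ + 6 : ℕ) : ℝ) * n) * ((2 : ℝ) ^ (3 * n))⁻¹)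
        = ((((2 ^ n * 𝓛.card * n ^ h : ℕ)) : ℝ) *
            (2 : ℝ) ^ (-((n : ℝ) / 2 * Real.logb 2 n) - ((κ + 6 : ℕ) : ℝ) * n)) *
            ((2 : ℝ) ^ n * 3 ^ n * ((2 : ℝ) ^ (3 * n))⁻¹) := by ring
      _ ≤ 1 / 16 * 1 := mul_le_mul h6 hb (by positivity) (by norm_num)
      _ = 1 / 16 := by norm_num
  have hJR : (J.card : ℝ) ≤
      (((2 ^ n * 2 ^ n * 3 ^ n * ((n / 2 + 1) * (Fintype.card (Sym2 (Fin n))).choose (n / 2))) : ℕ) : ℝ) +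
      (((2 ^ n * 3 ^ n * (2 ^ n * 𝓛.card * n ^ h)) : ℕ) : ℝ) := by
    have : J.card ≤ JP.card + JT.card := by rw [hJ]; exact card_union_le _ _
    exact_mod_cast this.trans (Nat.add_le_add hJP' hJT')
  have := mul_le_mul_of_nonneg_right hJR hδpos.le
  rw [add_mul] at this
  linarith

/-- **MASTER HALF BOUND** at entropy rate `κ`: eventually a list of `≤ 2^{κn}` edge sets such that every bisection-robust
4-edge-critical `F` has a near-half cut `B`, a sub-core `R` with `F[B]` core-rigid on `R` (witness `c₀`), and a
sandwiched floppy set `F[B] ⊆ F[R] ∪ β`, `β ⊆ F[B]`, that is small (`≤ n/2` edges) or a placed listed inside.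
`MixedHalfBound` and (`RobustHalfTypeBound T`, `T ≤ 2^{κn}` eventually) are the instances `𝓛 = ∅` and `R = ∅`.  OPEN. -/
def MasterHalfBound (κ : ℕ) : Prop :=
  ∀ᶠ n in Filter.atTop, ∃ 𝓛 : Finset (Finset (Sym2 (Fin n))), 𝓛.card ≤ 2 ^ (κ * n) ∧
    ∀ F : Finset (Sym2 (Fin n)), BisectionRobustCritical F →
      ∃ B : Finset (Fin n), (n ≤ 2 * B.card ∧ 2 * B.card ≤ n + 1) ∧
        ∃ R : Finset (Fin n), ∃ c₀ : Fin n → Fin 3, CoreRigidInside B R F c₀ ∧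
          ∃ β ⊆ bobSide B F, bobSide B F ⊆ bobSide R F ∪ β ∧
            (β.card ≤ n / 2 ∨ ∃ H ∈ 𝓛, ∃ σ : Equiv.Perm (Fin n), β = bobSide B (relabel σ H))

theorem masterHalfBound_of_mixedHalfBound (h : MixedHalfBound) (κ : ℕ) : MasterHalfBound κ := by
  refine h.mono fun n hn => ⟨∅, by simp, fun F hF => ?_⟩
  obtain ⟨B, hB, R, c₀, hrig, β, hβ, hcard, hcover⟩ := hn F hF
  exact ⟨B, hB, R, c₀, hrig, β, hβ, hcover, Or.inl hcard⟩

theorem masterHalfBound_of_robustHalfTypeBound {T : ℕ → ℕ} (hT : RobustHalfTypeBound T) {κ : ℕ}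
    (hκ : ∀ᶠ n in Filter.atTop, T n ≤ 2 ^ (κ * n)) : MasterHalfBound κ := by
  refine hκ.mono fun n hn => ?_
  obtain ⟨𝓛, h𝓛, hall⟩ := hT n
  refine ⟨𝓛, h𝓛.trans hn, fun F hF => ?_⟩
  obtain ⟨K, hKc, H, hH, σ, hEq⟩ := hall F hF
  refine ⟨K, ⟨by omega, by omega⟩, ∅, fun _ => 0, coreRigidInside_empty K F _, bobSide K F, subset_rfl,
    subset_union_right, Or.inr ⟨H, hH, σ, hEq⟩⟩

/-- **`MasterHalfBound κ ⇒ ¬X1`** (at `C = κ + 9`). -/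
theorem foolingMeasure_false_of_masterHalfBound {κ : ℕ} (h : MasterHalfBound κ) :
    ¬ Summit.PneNP.PneNP.Theses.AeaCutRectangles.FoolingMeasure := by
  classical
  intro hX1
  obtain ⟨N, hN⟩ := Filter.eventually_atTop.1 h
  obtain ⟨n, hnN, hn2, μ, hμ, hsum, hs, hX⟩ := foolingMeasure_schedule hX1 (κ + 9) N
  obtain ⟨𝓛, h𝓛, hall⟩ := hN n hnN
  refine false_of_masterCover hn2 μ hμ hsum hs 𝓛 h𝓛 (fun S hS => ?_) hX
  obtain ⟨hl, hc⟩ := hs S hS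
  have hF := core_critical S hl hc
  have hFS := core_subset S
  refine ⟨core S, hFS, hF.2.1, ?_⟩
  by_cases hrob : ∀ S' : Finset (Fin n), n ≤ 2 * S'.card → n < 2 * (bobSide S' (core S)).card
  · exact hall (core S) ⟨hF, hrob⟩
  · push Not at hrob
    obtain ⟨S', hS', hcard⟩ := hrob
    obtain ⟨B, hBS', hBc⟩ := exists_subset_card_eq (show (n + 1) / 2 ≤ S'.card by omega)
    have hle : (bobSide B (core S)).card ≤ n / 2 := by
      have := card_le_card (bobSide_mono_left hBS' (core S))
      omega
    exact ⟨B, ⟨by rw [hBc]; omega, by rw [hBc]; omega⟩, ∅, fun _ => 0, coreRigidInside_empty B _ _,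
      bobSide B (core S), subset_rfl, subset_union_right, Or.inl hle⟩

/-- Kill path under the master half bound. -/
theorem noFoolingMeasure_of_masterHalfBound {κ : ℕ} (h : MasterHalfBound κ) :
    Summit.PneNP.PneNP.Theses.AeaCutRectangles.NoFoolingMeasure :=
  foolingMeasure_false_of_masterHalfBound h

/-- **THE CONSTRUCT SIDE'S BURDEN IN ONE QUANTITY: hitting entropy of the UNFORCED part of EVERY near-half.**  X1 forces,
for every `κ`, infinitely often: for every list of `≤ 2^{κn}` edge sets some bisection-robust 4-edge-critical `F` such
that in EVERY near-half `B`, for EVERY sub-core `R` on which `F[B]` forces a partition and EVERY sandwiched floppy set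
`β` (`F[B] ⊆ F[R] ∪ β`, `β ⊆ F[B]`): `β` has MORE than `n/2` edges AND is not a placed listed inside. -/
theorem foolingMeasure_imp_unforcedEntropy (hX1 : Summit.PneNP.PneNP.Theses.AeaCutRectangles.FoolingMeasure)
    (κ : ℕ) :
    ∃ᶠ n in Filter.atTop, ∀ 𝓛 : Finset (Finset (Sym2 (Fin n))), 𝓛.card ≤ 2 ^ (κ * n) →
      ∃ F : Finset (Sym2 (Fin n)), BisectionRobustCritical F ∧
        ∀ B : Finset (Fin n), (n ≤ 2 * B.card ∧ 2 * B.card ≤ n + 1) →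
          ∀ (R : Finset (Fin n)) (c₀ : Fin n → Fin 3), CoreRigidInside B R F c₀ →
            ∀ β ⊆ bobSide B F, bobSide B F ⊆ bobSide R F ∪ β →
              n / 2 < β.card ∧ ∀ H ∈ 𝓛, ∀ σ : Equiv.Perm (Fin n), β ≠ bobSide B (relabel σ H) := by
  by_contra hcon
  rw [Filter.not_frequently] at hcon
  have h : MasterHalfBound κ := by
    refine hcon.mono fun n hn => ?_
    by_contra h'
    push Not at h'
    apply hn
    intro 𝓛 h𝓛
    obtain ⟨F, hF, hrest⟩ := h' 𝓛 h𝓛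
    refine ⟨F, hF, fun B hB R c₀ hrig β hβ hcover => ?_⟩
    exact hrest B hB R c₀ hrig β hβ hcover
  exact foolingMeasure_false_of_masterHalfBound h hX1

end Master

/-! ### Audit -/

example : RobustHalfTypeBound (fun _ => 0) → Summit.PneNP.PneNP.Theses.AeaCutRectangles.NoFoolingMeasure :=
  fun h => noFoolingMeasure_of_fewRobustHalfTypes h (κ := 0) (Filter.Eventually.of_forall fun n => by simp)

example {δ : ℝ} (hδ : δ < 1 / 2) (h : RigidCoreLocalization 1 δ) :
    Summit.PneNP.PneNP.Theses.AeaCutRectangles.NoFoolingMeasure :=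
  foolingMeasure_false_of_rigidCoreLocalization hδ h


example (h : MixedHalfBound) : Summit.PneNP.PneNP.Theses.AeaCutRectangles.NoFoolingMeasure :=
  noFoolingMeasure_of_mixedHalfBound h


example (h : MasterHalfBound 3) : Summit.PneNP.PneNP.Theses.AeaCutRectangles.NoFoolingMeasure :=
  noFoolingMeasure_of_masterHalfBound h

end Summit.PneNP.PneNP.Cruxes.FoolingMeasure.P4g15
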